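import Summits.QuantumFields.YangMills.Theorems.BalabanUVNodesN06Thm312313AtPinsStateSUCLEParG
import Summits.QuantumFields.YangMills.Theorems.BalabanUVNodesN06ZLettersLegAtPinsPUParJ

/-!
# BalabanUVNodes ∕ N06 ([B9], `Dag.B9_main`) — R1 J-TWIN: THEOREMS 3.12 ∕ 3.13 AT THE PINS FROM THE STATE TUPLES, THE C-LETTERS AND THE SECT.-D LETTERS («t312 ∧ t313» at the
# knit averaging, site-transporter-parametric), ALONG A SUB-FAMILY `f : J → MemberY …` — the J-twin of ✓`…N06Thm312313AtPinsStateSUCLEParG.t312_t313_of_pins_stateSUCLE_parG`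
# (consumer «KD‴» `…N06AtOpsYSectEStKnitSectDKDR` l.349 → its twin) — EDITION B (supersedes ✓`…ParGJ`: two more tainted slots)

Track A of `YM-PLAN.md` (cell `pub-ymgap`, HUMAN RULING D-0062), node **N06** = [Balaban1985BackgroundPropagators]; IR-N06-SECTION-2 road **R1** («J-twin of the
producer cone», ★★★ director-ym №524 (3): authorised in principle, STAGED, sibling files only), `R1-JTWIN-SPEC.md` rule (R)′ (dag-n06-d, 2026-08-31): re-key EXACTLY
the section-tainted ∀-member rows along `f`, keep data ∕ pins ∕ laws ∕ section-free rows member-wide, tainted conclusions along `f` ((R).3′).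
Seat `pub-ymgap-dag-n06-d` g30 — own-producer twins under «KD‴».  The two S-leaves of print (n06-k ∕ n06-i lineage ✓`B9Thm312WholeLeafCompletePairMBZSLRC.thm312Printed_completePairMBZSL_ratesC`,
✓`B9Thm313WholeLeafCompletePairMBCZcUSXCEL.thm313Printed_completePairMBCZcUSXCEL`) are INDEX-GENERIC (`{I} {geo : I → B9.Geometry} {bg : I → B9.Backgrounds}`), so this twin
instantiates them at `I := J`, `geo := fun j => geo9Y (f j)` — every MemberY-indexed family argument is passed along `f` (`fun j => 𝔬12 (f j)`, …), Lemma 2.1-above-G is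
re-indexed along `f` in three lines (`hL21f`), and the C-letters come from ✓`…N06ZLettersLegAtPinsPUParJ.zletters_of_laws_J`.

EDITION B vs ✓`…N06Thm312313AtPinsStateSUCLEParGJ` (p817123): the kernel-level dataflow of «KD‴» shows TWO MORE slots fed by rows 15∕16 — `hwGp13` (the W·G′ word `h13`
of ✓`…N06WGpLegAtPinsPhysPUPar`) and `hrgdH13` (the rigid letter `hrg` of ✓`…N06RgdH43LegAtPinsPhysPUPar`), both of which take the (3.49) majorant through «KD‴»'s
MERGED-THRESHOLD family `h49m` POSITIONALLY (invisible to a named-argument taint scan); their legs are twinned as ✓`…WGpLegAtPinsPhysPUParJ` ∕ ✓`…RgdH43LegAtPinsPhysPUParJ`,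
and this edition re-keys the two slots.  The first edition stays a correct (weaker) twin, orphan.
WHAT.  `t312_t313_of_pins_stateSUCLE_parG_JB` = the parent's theorem with `{J : Type} (f : J → MemberY θ.d₆ θ.ℓ₆ θ.hd' θ.hL' θ.b₀ θ.b₁ Mstar)` added after the `H12` binder and
* TAINTED ROWS OF THIS TWIN (kernel-read at «KD‴» l.349–358; the threshold ∕ sign facts about x-free reals are NOT rows): `h26` (the (3.132) reading = KD‴'s `s3132K` ⟸ the state
  via dag-n06-l's `…Eq3132FromStateKnitQ`; now the family-level predicate at `I := J`), `hmodel12` (`FormSmall ∧ Identities` ⟸ L2's `hFI` ⟸ row 17), `hStL` (the block-L² step ⟸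
  L2's `hstepL2` ⟸ (3.49)), `hLH3` (the slot is fed through `Letters313HZc.of_HZ … (hWE …)` ⟸ (3.49)), `hLL2` (fed by `hRGI hRGD hcut` = ✓`…RgdILeg∕RgdDsLeg∕CutL2Letters…ParJ` ⟸
  (3.49) + `h152`), `hrgdd13` (L2's `hRG` ⟸ the state), `hrgd2_13` (slot fed by `(hids …).2` ⟸ row 17 and by `hr2` ⟸ (3.49) via `h49m`), `h152` (`hids`), `hwGp13` (⟸ `h13` ⟸ `h49m`), `hrgdH13` (⟸ `hrg` ⟸ `h49m`), and the four STATE TUPLES `hst20 hst10 hst21 hst11`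
  (⟸ `h49 hta hD2`); each re-keyed `∀ x : MemberY … ↦ ∀ j : J`, read at `f j`;
* LEFT member-wide: every letter family ∕ pin ∕ law ∕ instance binder (`𝔒 𝔏 𝔮 𝔮s parS Δ2 bI 𝔭A Dd Dds 𝔬12 H12 bH13 bHX12 bHW13 Gp bXH …`, `hC1T hqK hqsK hsymD hG0C hLHH hdgDvd13
  hpdgDvd13 hZ2 hG0e hdgDH13 hlettersDM13 he1 hdomX hdomW hIF hHCN hH1N hpinE hpinH hpinK …` — section-free: laws, Theorem 3.3 ∕ 3.10's G₀ layer, the DgDvd ∕ XdYd ∕ Dv ∕ G₀Q⋆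
  legs, the HH-leg, the readings), all x-free numerics ∕ rates ∕ thresholds ∕ state constants;
* conclusion `B9.Thm312Printed (θ.d₆+1) c (fun j => geo9Y (f j)) (fun j => bg9YR … (f j)) (fun j => kernelFamilyR R₁ R₂ (𝔒 (f j)).GD) … ∧ B9.Thm313Printed c (fun j => geo9Y (f j)) …` —
  print's two theorems for the sub-family, EXACTLY the shapes of `B9LeafXCodedKnitU.*_reindex f` ((R).3).
PROOF = the parent's text with: `h26` rewritten to the ν-normalised kernels pointwise (`congrFun` of the parent's two `funext` identities, `simp only` under the `j`-binder);
`zletters_of_laws_J … H12 f …`; `hL21f` (Lemma 2.1 above G along `f`: `fun j hM => h (f j) hM`); the two leaf applications with every family argument along `f` and the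
tainted rows `… j`; the member-wide `have`s (`hco*`, `hDL …`, `hsym12∕13`, `e𝔒*`) byte-identical.  Nothing of the leaves re-derived.
HONEST FRAMING.  Bookkeeping over landed objects; every displayed row is a HYPOTHESIS; nothing of [B9] ∕ [4] asserted; COUNT-NEUTRAL (`--supports stmt-QuantumFields-27239
--as helper`); N06 NOT discharged; K1 NOT closed; under R1 the inner-corner question stays DISPLAYED at the K1 face ∕ NODE O join by (α5); nothing continuum ∕ OS ∕
mass gap ∕ Clay.  0 `def`, 0 `sorry`.  NEW file; the parent untouched.  The member-wide parent is the instance `J := MemberY …`, `f := id`; ORPHAN by design until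
«KD‴»ᴶ lands (honest).
[cite: Balaban1985BackgroundPropagators, Thm 3.12 (3.137)–(3.138) p.423, Thm 3.13 (3.151)–(3.153) p.426, (3.130)–(3.133) pp.421–422, (3.42)–(3.47) pp.397–398, Thm 3.3 p.399;
Balaban1984PropagatorsII, (2.51)–(2.56) pp.232–233, Lemma 2.1 (2.60)–(2.61) p.234, (2.147)–(2.149) p.249]
-/

noncomputable section

namespace Summit.QuantumFields.YangMills.BalabanUVNodes.N06Thm312313AtPinsStateSUCLEParGJB


open Literature.MathematicalPhysics.QuantumFieldTheory.Balaban1983to89.B9QLettersAtPins (hasMaj_Q_of_pins) open Summit.QuantumFields.YangMills.BalabanUVNodes.N06ZLettersLegAtPinsPU (scaled_rates) open Summit.QuantumFields.YangMills.BalabanUVNodes.N06ZLettersLegAtPinsPUPar (zletters_of_laws) open Literature.MathematicalPhysics.QuantumFieldTheory.Balaban1983to89.Node00.OpsYOps312OfRecordPar (CcoKq C1coKq) open Literature.MathematicalPhysics.QuantumFieldTheory.Balaban1983to89.Node00.OpsYQLetter (QFamY QsFamY) open Literature.MathematicalPhysics.QuantumFieldTheory.Balaban1983to89.B9LettersZCFieldsAtPins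 (c1_l2_of_c1_2) open Literature.MathematicalPhysics.QuantumFieldTheory.Balaban1983to89.B9Thm37Glue (IsTransposePair) open Literature.MathematicalPhysics.QuantumFieldTheory.Balaban1983to89.B9LettersZSchemasMono (kernel_mono letters313DZ_mono letters313DMZ_mono) open Literature.MathematicalPhysics.QuantumFieldTheory.Balaban1983to89.B9Eq3132SectDLetters (QGQinvY) open Literature.MathematicalPhysics.QuantumFieldTheory.Balaban1983to89.B9Eq3132NuReading (siteKernelOfOpNu nuY) open Literature.MathematicalPhysics.QuantumFieldTheory.Balaban1983to89.B9LettersHZAtOne (plateau_pos) open Literature.MathematicalPhysics.QuantumFieldTheory.Balaban1983to89.B7Prop2SpecialUnitary (specialUnitaryUnits_le_U1) open Literature.MathematicalPhysics.QuantumFieldTheory.Balaban1983to89.Node00.OpsYSectDCoords (QcoKH QscoKH CcoK C1coK)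
open Literature.MathematicalPhysics.QuantumFieldTheory.Balaban1983to89.B9BackgroundsKLevelV1R (RegFamY bg9YR MemOfFam mem_of_reg335R kernelFamilyR kernelFamilyRY hKernelR hKernelRY siteKernelR) open Literature.MathematicalPhysics.QuantumFieldTheory.Balaban1983to89.B9OpsRTransport (ops312RY)
open Literature.MathematicalPhysics.QuantumFieldTheory.Balaban1983to89 open Literature.MathematicalPhysics.QuantumFieldTheory.Balaban1983to89.T4Continuum (T4Family) open Literature.MathematicalPhysics.QuantumFieldTheory.Balaban1983to89.DagBinding (WorldP leavesP) open Literature.MathematicalPhysics.QuantumFieldTheory.Balaban1983to89.Node00 open Literature.MathematicalPhysics.QuantumFieldTheory.Balaban1983to89.B6KLevelCensusIndexV1 (KIdx) open Literature.MathematicalPhysics.QuantumFieldTheory.Balaban1983to89.B9PinMembersKLevelV1 (MemberY geo9Y bg9Y) open Literature.MathematicalPhysics.QuantumFieldTheory.Balaban1983to89.B9PinGeometryKLevelV1 (dOmegaY OmKY inΛY unitDistY InCubeY c35Y c35Y_pos) open Literature.MathematicalPhysics.QuantumFieldTheory.Balaban1983to89.B7Prop2SpecialUnitary (specialUnitaryUnits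 specialUnitaryUnits_le_unitaryUnits) open Literature.MathematicalPhysics.QuantumFieldTheory.Balaban1983to89.B9Ineq347GAAtLetters (hGA_opsYOfLetters) open Literature.MathematicalPhysics.QuantumFieldTheory.Balaban1983to89.B9Ineq344LocalPairHolds (hGp_opsYOfLetters_holds) open Literature.MathematicalPhysics.QuantumFieldTheory.Balaban1983to89.B9Cor35ComparisonsGAAtLetters
  (hGA_e_opsYOfLetters hGA_h1_opsYOfLetters hGA_e4_opsYOfLetters hGA_h2_opsYOfLetters hGA_l2_opsYOfLetters)
open Literature.MathematicalPhysics.QuantumFieldTheory.Balaban1983to89.B9Cor35ComparisonsGpCAtLetters (hGp_e_opsYOfLetters hGp_h1_opsYOfLetters hC_opsYOfLetters) open Literature.MathematicalPhysics.QuantumFieldTheory.Balaban1983to89.B9Cor35ComparisonsEH (hE4_of_hGA_e4 hH2_of_hGA_h2) open Literature.MathematicalPhysics.QuantumFieldTheory.Balaban1983to89.B9Thm314Thm315RecordVacuity (thm315FullPrinted_of_ker_zero) open Literature.MathematicalPhysics.QuantumFieldTheory.Balaban1983to89.B9RecordDELettersVacuity (siteKernelOfOp_zero_ker fineKernelOfOp_zero_ker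 stmt349Printed_of_ker_zero) open Literature.MathematicalPhysics.QuantumFieldTheory.Balaban1983to89.B9GeoLemma21KLevelV1 (geo9Y_len_pos) open Literature.MathematicalPhysics.QuantumFieldTheory.Balaban1983to89.B9Thm311Whole (PosDefOfOps) open Literature.MathematicalPhysics.QuantumFieldTheory.Balaban1983to89.B9Thm39Whole (WalkReading39) open Literature.MathematicalPhysics.QuantumFieldTheory.Balaban1983to89.B9Thm39WholeBlk (Ops39Blk StaticOK39Blk Locality39Blk Local348Blk Identities395Blk Small285Blk Factors389Blk)
open Literature.MathematicalPhysics.QuantumFieldTheory.Balaban1983to89.B9Thm39WholeBlkViaDatum (EK39OfOpsBlkVia) open Literature.MathematicalPhysics.QuantumFieldTheory.Balaban1983to89.B9Thm39ReadingCoords (repSite39) open Literature.MathematicalPhysics.QuantumFieldTheory.Balaban1983to89.B9Thm39ReadingAtLetters (X39 blk39 L39 t39_hksum_of_pins_opsYOfLetters) open Literature.MathematicalPhysics.QuantumFieldTheory.Balaban1983to89.B9RowSum261DefiniteFaces (rowConst261) open Summit.QuantumFields.YangMills.BalabanUVNodes.N06AtRecord11ObligationsPins (t311_of_pin) open Summit.QuantumFields.YangMills.BalabanUVNodes.N06AtRecord11ObligationsHg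 (hg_obligation_vacuous) open Summit.QuantumFields.YangMills.BalabanUVNodes.N06AtRecord11CB10YZW (b9_main_of_up_view₁₁B10YZW_of_obligations) open Literature.MathematicalPhysics.QuantumFieldTheory.Balaban1983to89.B9Thm312Whole (GeoOK Thm33G0 FormSmall HasRWExpOfOps HasRWExpHOfOps PosDefKOfOps) open Literature.MathematicalPhysics.QuantumFieldTheory.Balaban1983to89.B11SectG (RowSum BlockNorm) open Literature.MathematicalPhysics.QuantumFieldTheory.Balaban1983to89.B9FromB6 (L2Block) open Literature.MathematicalPhysics.QuantumFieldTheory.Balaban1983to89.B9Thm312WholeH (LettersH) open Literature.MathematicalPhysics.QuantumFieldTheory.Balaban1983to89.B9Thm312WholeLeft (LeftStep)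
open Literature.MathematicalPhysics.QuantumFieldTheory.Balaban1983to89.B9Thm313WholeLeft (Letters313D) open Literature.MathematicalPhysics.QuantumFieldTheory.Balaban1983to89.B9Thm313Whole (Letters313) open Literature.MathematicalPhysics.QuantumFieldTheory.Balaban1983to89.B9Ineq347CoReading (CoReadsGlob) open Literature.MathematicalPhysics.QuantumFieldTheory.Balaban1983to89.B9Thm312WholeFacesY (lemma21AboveG_geo9Y) open Literature.MathematicalPhysics.QuantumFieldTheory.Balaban1983to89.B9GeoNormsKLevelV1 (geo9K_dist_nonneg) open Literature.MathematicalPhysics.QuantumFieldTheory.Balaban1983to89.B9GeoLemma21KLevelV1 (distOK_geo9Y rowSum261_geo9Y geo9Y_dist_triangle geo9Y_dist_comm) open Literature.MathematicalPhysics.QuantumFieldTheory.Balaban1983to89.B9GeoNormsKLevelModelSignsV1 (modelSignsOn_geo9K) open Literature.MathematicalPhysics.QuantumFieldTheory.Balaban1983to89.B9Thm34Ext (toB6) open Literature.MathematicalPhysics.QuantumFieldTheory.Balaban1983to89.B9CoRealizesRel (CoRealizesRel) open Literature.MathematicalPhysics.QuantumFieldTheory.Balaban1983to89.B9CoRealizesRelAtLetters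 (RelB maj342_relB_left maj342_relB_right dist_eq_of_relB len_eq_of_relB relB_refl)
open Literature.MathematicalPhysics.QuantumFieldTheory.Balaban1983to89.B9CoRealizesHRel (CoRealizesHRel) open Literature.MathematicalPhysics.QuantumFieldTheory.Balaban1983to89.B9SectCDiffDict (maj342) open Literature.MathematicalPhysics.QuantumFieldTheory.Balaban1983to89.B6Ineq2142KLevelV1 (β) open Literature.MathematicalPhysics.QuantumFieldTheory.Balaban1983to89.B9CarrierBlockMultiplicity (card_sameCarrier_le_kIdx) open Literature.MathematicalPhysics.QuantumFieldTheory.Balaban1983to89.B9Thm312WholeLeafRelH (thm312Printed_of_stepRelH) open Literature.MathematicalPhysics.QuantumFieldTheory.Balaban1983to89.B9Thm313WholeLeafRel (thm313Printed_of_stepRel) open Literature.MathematicalPhysics.QuantumFieldTheory.Balaban1983to89.B9Eq3132SectDLetters (QGQY) open Literature.MathematicalPhysics.QuantumFieldTheory.Balaban1983to89.B9Eq3132CTInputs (CoerciveUnder DecayUnder) open Literature.MathematicalPhysics.QuantumFieldTheory.Balaban1983to89.B9Eq3132ScalarIndex (geoComap) open Literature.MathematicalPhysics.QuantumFieldTheory.Balaban1983to89.B9Eq3132RingInverseReading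 (normMatY) open Literature.MathematicalPhysics.QuantumFieldTheory.Balaban1983to89.B9Ineq349SiteReading (opsYS349OfRecordDE) open Literature.MathematicalPhysics.QuantumFieldTheory.Balaban1983to89.B9Eq3132AtRecordDE (s3132_opsYOfRecordDE)
open Literature.MathematicalPhysics.QuantumFieldTheory.Balaban1983to89.B9Thm314Thm315RecordDE (thm314_pair_opsYOfRecordDE t315_opsYOfRecordDE_of_slots) open Literature.MathematicalPhysics.QuantumFieldTheory.Balaban1983to89.B9Thm311ReadingAtLetters (ops311Y) open Literature.MathematicalPhysics.QuantumFieldTheory.Balaban1983to89.B9Thm311ReadingCoords (PosDefTr) open Literature.MathematicalPhysics.QuantumFieldTheory.Balaban1983to89.B9Thm311SymmAtRecordV4 (proofLettersOneV4) open Literature.MathematicalPhysics.QuantumFieldTheory.Balaban1983to89.B9Thm311PosAtRecordV4 (t311_of_pins_opsYOfLettersV4₁) open Literature.MathematicalPhysics.QuantumFieldTheory.Balaban1983to89.B9PinGeometryKLevelV1 (kLab) open Literature.MathematicalPhysics.QuantumFieldTheory.Balaban1983to89.B9Thm314GpFlatTorusGeometry (tdistK OmegaC) open Literature.MathematicalPhysics.QuantumFieldTheory.Balaban1983to89.B9Thm314WholePinGeometry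 (locDataY) open Literature.MathematicalPhysics.QuantumFieldTheory.Balaban1983to89.B9Thm314WholePair (locData₂) open Literature.MathematicalPhysics.QuantumFieldTheory.Balaban1983to89.B9Thm314WholePairWalks (pairWalkSets) open Literature.MathematicalPhysics.QuantumFieldTheory.Balaban1983to89.B9Thm314WholeSummation (WalkSetsSpec WalkWeightsSummable) open Literature.MathematicalPhysics.QuantumFieldTheory.Balaban1983to89.B9SectCWalkTermsAllNorms (Thm310AllNormsPrinted) open Literature.MathematicalPhysics.QuantumFieldTheory.Balaban1983to89.B9Thm314WholeExpansionReads (ExpansionReads) open Literature.MathematicalPhysics.QuantumFieldTheory.Balaban1983to89.B9Thm314WholeCancellationLayer (pairOp) open Literature.MathematicalPhysics.QuantumFieldTheory.Balaban1983to89.B9Thm37Whole (Ops Sizes StaticOK Local342 Identities)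
open Literature.MathematicalPhysics.QuantumFieldTheory.Balaban1983to89.B9Cor38Whole (WalkReading Locality) open Literature.MathematicalPhysics.QuantumFieldTheory.Balaban1983to89.B9Thm310Whole (Ops310 WalkReading310 Sizes310 StaticOK310 Locality310 Local342G Identities310) open Literature.MathematicalPhysics.QuantumFieldTheory.Balaban1983to89.B9RWSumsDefinitePins (PinPrims) open Literature.MathematicalPhysics.QuantumFieldTheory.Balaban1983to89.B9RWSumsDefinitePinsPair (PairPrims) open Literature.MathematicalPhysics.QuantumFieldTheory.Balaban1983to89.B9RWSumsDefinitePinsPairM (MixedPrims E37YPairM E310YPairM rows131819_definite_geo9Y_pairM) open Literature.MathematicalPhysics.QuantumFieldTheory.Balaban1983to89.B9RWSums344InputFam (InputReadsFam sliceProbe) open Literature.MathematicalPhysics.QuantumFieldTheory.Balaban1983to89.B9RWSums344InputPair (InputLegsPair37 FactorsInputPair37 DirSupHolder37 InputLegsPair310 FactorsInputPair310 DirSupHolder310) open Literature.MathematicalPhysics.QuantumFieldTheory.Balaban1983to89.B9RWSums346MixedPair (L2MixedLegs37 FactorsL2Mixed37 DirSup37 L2MixedLegs310 FactorsL2Mixed310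 DirSup310) open Literature.MathematicalPhysics.QuantumFieldTheory.Balaban1983to89.B9CoReadingCoordsTranspose (TrIdx trBasis isTransposePair_GcoK_trBasis isTransposePair_DcoK_GcoK_trBasis isTransposePair_GcoS_trBasis isTransposePair_DcoS_GcoS_trBasis) open Literature.MathematicalPhysics.QuantumFieldTheory.Balaban1983to89.B9Thm311SymmAtRecordV4 (symm0_parSymY symmG_parSymY) open Literature.MathematicalPhysics.QuantumFieldTheory.Balaban1983to89.B9Thm311AdjointPairs (GpY_isSymmTr) open Literature.MathematicalPhysics.QuantumFieldTheory.Balaban1983to89.B9RWSums346SecondDiff (familyOp DirOps310 DirTranspose310 L2SecondLegs310 FactorsL2Second310) open Literature.MathematicalPhysics.QuantumFieldTheory.Balaban1983to89.B9RWSums346SecondDiffGp (DirOps37 DirTranspose37 L2SecondLegs37 FactorsL2Second37) open Literature.MathematicalPhysics.QuantumFieldTheory.Balaban1983to89.B9Thm37Glue (IsTransposePair) open Literature.MathematicalPhysics.QuantumFieldTheory.Balaban1983to89.B9RWSums343to347Whole (GlobReads) open Literature.MathematicalPhysics.QuantumFieldTheory.Balaban1983to89.B9RWSumsReadsNbr (nbr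 L2ReadsNbr H1ReadsNbr InputReadsNbr) open Literature.MathematicalPhysics.QuantumFieldTheory.Balaban1983to89.B9RWSums346Two (L2TwoLegs310 FactorsL2_310) open Literature.MathematicalPhysics.QuantumFieldTheory.Balaban1983to89.B9RWSums346TwoGp (L2TwoLegs37 FactorsL2_37) open Literature.MathematicalPhysics.QuantumFieldTheory.Balaban1983to89.B9RWSums344Input (InputLegs310 FactorsInput310)
open Literature.MathematicalPhysics.QuantumFieldTheory.Balaban1983to89.B9RWSums344InputGp (InputLegs37 FactorsInput37) open Literature.MathematicalPhysics.QuantumFieldTheory.Balaban1983to89.B9RWSums343Holder (HolderProbes HolderLegs310 FactorsHolder310) open Literature.MathematicalPhysics.QuantumFieldTheory.Balaban1983to89.B9RWSums343HolderGp (HolderLegs37 HolderV37) open Literature.MathematicalPhysics.QuantumFieldTheory.Balaban1983to89.B9SectBStepFrameV4 (SectBFrame₄) open Summit.QuantumFields.YangMills.BalabanUVNodes.N06SectBOfFrameV4 (hB_obligation_of_sectBFrame₄)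
open Literature.MathematicalPhysics.QuantumFieldTheory.Balaban1983to89.B9CoReadingCoords (XBK evBK blkBK GcoK DcoK DscoK LcoK coordOpK cdBₗ cdsBₗ) open Literature.MathematicalPhysics.QuantumFieldTheory.Balaban1983to89.B9CoReadingCoordsS (XSK evSK blkSK sIK sIK_faithful GcoS DcoS DscoS LcoS) open Literature.MathematicalPhysics.QuantumFieldTheory.Balaban1983to89.B9CoReadingCoordsL2S (sIK_dist_le_one site_l2ReadsNbr012_of_pins site_l2ReadsNbr345_of_pins) open Literature.MathematicalPhysics.QuantumFieldTheory.Balaban1983to89.B9CoReadingCoordsL2Pair (bond_l2ReadsNbr345_of_pins) open Literature.MathematicalPhysics.QuantumFieldTheory.Balaban1983to89.B9Ineq349SiteComposite (cdSL cdsSL) open Literature.MathematicalPhysics.QuantumFieldTheory.Balaban1983to89.B9Thm312WholeLeafCompletePairM (thm312Printed_completePairM) open Literature.MathematicalPhysics.QuantumFieldTheory.Balaban1983to89.B9RWSumsCompleteGeo9YNbr (len_le_of_dist_le_two_geo9Y one_le_L_nat) open Literature.MathematicalPhysics.QuantumFieldTheory.Balaban1983to89.B9Thm312WholeDir (Thm33G0Dir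 Thm33G0L2M StepDir) open Literature.MathematicalPhysics.QuantumFieldTheory.Balaban1983to89.B9Thm312WholeL2 (StepL2) open Literature.MathematicalPhysics.QuantumFieldTheory.Balaban1983to89.B9Thm312WholeHHolder (LettersHH) open Literature.MathematicalPhysics.QuantumFieldTheory.Balaban1983to89.B9Thm312WholeHHolderNbr (CoReadsHHolderNbr) open Literature.MathematicalPhysics.QuantumFieldTheory.Balaban1983to89.B9Thm311ReadingCoords (IsSymmTr) open Summit.QuantumFields.YangMills.BalabanUVNodes.N06CoReadingsOfPins (bond_coReadings3_of_pins bond_coReadingsLap_of_pins site_coReadings4_of_pins bond_l2ReadsNbr3_of_pins) open Literature.MathematicalPhysics.QuantumFieldTheory.Balaban1983to89.B6Geom246MultiLevelTorus (geomT)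
open Literature.MathematicalPhysics.QuantumFieldTheory.Balaban1983to89.B9Eq3132NuReading (opsYS349NuOfLetters lamInvY) open Literature.MathematicalPhysics.QuantumFieldTheory.Balaban1983to89.B9GeoNbrCountKLevelV1 (nbrM₀Y nbrCountY hnbr_two_of_le) open Literature.MathematicalPhysics.QuantumFieldTheory.Balaban1983to89.B9CoReadingCoordsH (XHK blkHK HcoK coRealizesHRel_of_pins)
open Literature.MathematicalPhysics.QuantumFieldTheory.Balaban1983to89.B9Ineq349SiteFromBlocks (Thm31SiteSchemas Thm32BlkSchema stmt349Printed_site_of_blockSchemas) open Literature.MathematicalPhysics.QuantumFieldTheory.Balaban1983to89.B6GlobalChartV1 (blkV1) open Literature.MathematicalPhysics.QuantumFieldTheory.Balaban1983to89.B6Ineq2142KLevelV1 (lvl) open Literature.MathematicalPhysics.QuantumFieldTheory.Balaban1983to89.B9Thm315WholeSectERep (LocalOuterY) open Literature.MathematicalPhysics.QuantumFieldTheory.Balaban1983to89.B9Thm315WholeSectERepOn (DecayMidOnY t315_opsYSectE_of_3185_on) open Literature.MathematicalPhysics.QuantumFieldTheory.Balaban1983to89.B9Thm314WholeCancellationLayer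 (thm314_pair_layerOfLetters) open Literature.MathematicalPhysics.QuantumFieldTheory.Balaban1983to89.B9Thm314WholePinGeometry (locDataY_laws) open Literature.MathematicalPhysics.QuantumFieldTheory.Balaban1983to89.B9PinGeometryKLevelV1 (dOmegaY_nonneg) open scoped Matrix.Norms.L2Operator
open Literature.MathematicalPhysics.QuantumFieldTheory.Balaban1983to89.B9Thm313WholeLeafCompletePairMBCZcUSXCEL (thm313Printed_completePairMBCZcUSXCEL) open Literature.MathematicalPhysics.QuantumFieldTheory.Balaban1983to89.B9Thm313WholeLettersCut (Letters313Zc Letters313HZc Letters313L2Pc) open Literature.MathematicalPhysics.QuantumFieldTheory.Balaban1983to89.B9Thm313WholeRgdFrom3152 (Ids3152) open Literature.MathematicalPhysics.QuantumFieldTheory.Balaban1983to89.B9Thm313WholeZ (Letters313Z) open Literature.MathematicalPhysics.QuantumFieldTheory.Balaban1983to89.B9Thm313WholeLeftZ (Letters313DZ) open Literature.MathematicalPhysics.QuantumFieldTheory.Balaban1983to89.B9Thm313WholeDirZ (Letters313DMZ) open Literature.MathematicalPhysics.QuantumFieldTheory.Balaban1983to89.B9Thm313WholeHolderZ (Letters313HZ)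 open Literature.MathematicalPhysics.QuantumFieldTheory.Balaban1983to89.B9Thm313WholeL2GPZ (Letters313L2PZ) open Literature.MathematicalPhysics.QuantumFieldTheory.Balaban1983to89.B9Thm313WholeDirL2Z (Letters313L2MZ) open Literature.MathematicalPhysics.QuantumFieldTheory.Balaban1983to89.B9Thm312WholeLeafCompletePairMBZSLRC (thm312Printed_completePairMBZSL_ratesC) open Literature.MathematicalPhysics.QuantumFieldTheory.Balaban1983to89.B9Thm312WholeHZ (LettersHZ LettersHHZ) open Literature.MathematicalPhysics.QuantumFieldTheory.Balaban1983to89.B9SectDSup (weightNorm) open Literature.MathematicalPhysics.QuantumFieldTheory.Balaban1983to89.B9Thm313WholeDir (Thm33G0DirR Letters313DM Letters313L2M) open Literature.MathematicalPhysics.QuantumFieldTheory.Balaban1983to89.B9Thm313WholeHolder (Letters313H) open Literature.MathematicalPhysics.QuantumFieldTheory.Balaban1983to89.B9Thm313WholeL2GP (Letters313L2P)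

open B9Thm312WholeStepRegular (StepS) open B6RandomWalkHom (HasMajorantHom) open B9Thm312WholeClasses (cNormR rwt rwt_nonneg) open B9Thm312Whole (cNorm) open B11SectG (HasMaj) open B9SectDSup (weightNorm_κ)

variable {N : ℕ}

section Pointed

set_option maxHeartbeats 400000 in
set_option synthInstance.maxSize 512 in
/-- ★★★ **GUARD EDITION «G» (`hsymD` keyed to the (3.35) class, node00-def-Y ⚑ LOCATED-30) OF: ROWS 20–21 AT THE PINS ON THE S-LEAVES, FACE v1.7 «hrgdd LOSSY», RE-PRESSED GENERIC IN `(𝔒, 𝔏, 𝔮, 𝔮⋆, parS, Δ⁽²⁾)` [CASCADE-K K2]** — the assembler behind the knit certificate's displayed `t312K ∧ t313K`: the ops object `𝔒` enters through the Thm-3.12∕3.13 slot pins `hpinE∕H∕K` and the `rfl`-pins `h𝔒GD … h𝔒QG1Q` of its Sect.-D kernel slots to the letters `𝔏` and to def-Y's `𝔮`-generic (3.132) letters; the pins of `C ∕ C₁` read `CcoKq ∕ C1coKq`; the `Q ∕ Q⋆` letters and `C₁`'s self-transpose are displayed LAWS `hqK hqsK hC1T`; everything else is **FACE v1.7 (v1.6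 «c1 INSIDE» + the displayed letter `hrgdd13` in print's lossy Hölder species): class-parametric carrier `bg9YR R₁ R₂`, `U`-dependent Hölder intermediates `bH13 bXH bHW13`, the step and the
one-step pairs out of the regular state classes `𝔖₂ ∕ 𝔖₁`, NO raw Δ⁽²⁾ letter; Z-letter display `hZ2` (gD2 gQs1); the (3.132) letters from ROW 26 (`h26`), `gQs2 ∕ dgQs` from the G₀ layer,
`q2 ∕ q1` from the pin of Q, `rgd2` as `hrgd2_13`; master rates scaled after row 26's produced rate** (module docstring).
[cite: Balaban1985BackgroundPropagators, Thm 3.12 pp.421–423, Thm 3.13 pp.423–426, (3.130)–(3.133) pp.421–422, (3.138) p.423, (3.151)–(3.153) p.426, (3.35)–(3.36) p.396; Balaban1984PropagatorsII, (2.51)–(2.56) pp.232–233, Lemma 2.1 (2.60)–(2.61) p.234] -/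
theorem t312_t313_of_pins_stateSUCLE_parG_JB (θ : Stage3Params) (Mstar : ℕ) {R₁ R₂ : RegFamY θ.d₆ θ.ℓ₆ θ.hd' θ.hL' θ.b₀ θ.b₁ Mstar (Matrix (Fin N) (Fin N) ℂ)}
    (hGR : MemOfFam (specialUnitaryUnits (Fin N)) R₁) (c : ℝ)
    -- [CASCADE-K] the ops object, the letters, the averaging pair, the site transporter and the residual letter as PARAMETERS (v1.7: `opsYNuOfRecordV4PE … 𝔯 𝔢 𝔴 𝔈`, `lettersYOfRecordV4P … 𝔯`, `(QY parBY, QsY parBY)`, `parSymY`, `(𝔯 x).Δ2`)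
    (𝔒 : OpsY N θ Mstar) (𝔏 : LettersY N θ Mstar) (𝔮 : QFamY N θ) (𝔮s : QsFamY N θ) (parS : ∀ i : KIdx θ.d₆ θ.ℓ₆ θ.hd' θ.hL' θ.b₀ θ.b₁, SiteParY (Matrix (Fin N) (Fin N) ℂ) i)
    (Δ2 : ∀ x : MemberY θ.d₆ θ.ℓ₆ θ.hd' θ.hL' θ.b₀ θ.b₁ Mstar, BondOpY (Matrix (Fin N) (Fin N) ℂ) x.toKIdx)
    [∀ x : MemberY θ.d₆ θ.ℓ₆ θ.hd' θ.hL' θ.b₀ θ.b₁ Mstar, Fintype (geo9Y x).Site] [∀ x : MemberY θ.d₆ θ.ℓ₆ θ.hd' θ.hL' θ.b₀ θ.b₁ Mstar, DecidableEq (geo9Y x).Site] [∀ x : MemberY θ.d₆ θ.ℓ₆ θ.hd' θ.hL' θ.b₀ θ.b₁ Mstar, DecidableRel (RelB x.toKIdx)]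
    (bI : ∀ x : MemberY θ.d₆ θ.ℓ₆ θ.hd' θ.hL' θ.b₀ θ.b₁ Mstar, FBondY x.toKIdx → IBondY x.toKIdx)
    (hβI : ∀ (x : MemberY θ.d₆ θ.ℓ₆ θ.hd' θ.hL' θ.b₀ θ.b₁ Mstar) (f : FBondY x.toKIdx) (c : IBondY x.toKIdx), blkV1 x.hN x.D f = β x.hN x.D x.hk c → β x.hN x.D x.hk (bI x f) = blkV1 x.hN x.D f)
    (hlev : ∀ (x : MemberY θ.d₆ θ.ℓ₆ θ.hd' θ.hL' θ.b₀ θ.b₁ Mstar) (f : FBondY x.toKIdx), lvl x.hN x.D x.hk (bI x f) = (blkV1 x.hN x.D f).1.1)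
    (hβ1 : ∀ (x : MemberY θ.d₆ θ.ℓ₆ θ.hd' θ.hL' θ.b₀ θ.b₁ Mstar) (f : FBondY x.toKIdx), (geomT x.D).dist (β x.hN x.D x.hk (bI x f)) (blkV1 x.hN x.D f) ≤ 1)
    (hM₀ : nbrM₀Y θ.d₆ θ.ℓ₆ θ.hd' θ.hL' θ.b₀ θ.b₁ 2 ≤ Mstar) {PXA PYA : MemberY θ.d₆ θ.ℓ₆ θ.hd' θ.hL' θ.b₀ θ.b₁ Mstar → Type} [∀ x, Fintype (PXA x)] [∀ x, DecidableEq (PXA x)] [∀ x, Fintype (PYA x)] [∀ x, DecidableEq (PYA x)]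
    (𝔭A : ∀ x : MemberY θ.d₆ θ.ℓ₆ θ.hd' θ.hL' θ.b₀ θ.b₁ Mstar, HolderProbes (geo9Y x) (bg9YR (Matrix (Fin N) (Fin N) ℂ) (specialUnitaryUnits (Fin N)) R₁ R₂ x) (XBK (TrIdx N) x.toKIdx) (XBK (TrIdx N) x.toKIdx) (PXA x) (PYA x))
    -- the single-direction letters ∇_{U,μ} ∕ ∇*_{U,μ} on the bond carrier (in the certificate: `(𝔡A x).Dd ∕ .Dsd` of the Theorem-3.10 letters), PINNED to the coordinate letters
    (Dd Dds : ∀ x : MemberY θ.d₆ θ.ℓ₆ θ.hd' θ.hL' θ.b₀ θ.b₁ Mstar, (bg9YR (Matrix (Fin N) (Fin N) ℂ) (specialUnitaryUnits (Fin N)) R₁ R₂ x).Cfg → Fin (θ.d₆ + 1) → Module.End ℝ (XBK (TrIdx N) x.toKIdx → ℝ))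
    (hDd : ∀ (x : MemberY θ.d₆ θ.ℓ₆ θ.hd' θ.hL' θ.b₀ θ.b₁ Mstar) (U : (bg9YR (Matrix (Fin N) (Fin N) ℂ) (specialUnitaryUnits (Fin N)) R₁ R₂ x).Cfg), Dd x U = fun μ => coordOpK (trBasis N) (fun _ : Fin (θ.d₆ + 1) => cdBₗ x.toKIdx U μ)) (hDds : ∀ (x : MemberY θ.d₆ θ.ℓ₆ θ.hd' θ.hL' θ.b₀ θ.b₁ Mstar) (U : (bg9YR (Matrix (Fin N) (Fin N) ℂ) (specialUnitaryUnits (Fin N)) R₁ R₂ x).Cfg), Dds x U = fun μ => coordOpK (trBasis N) (fun _ : Fin (θ.d₆ + 1) => cdsBₗ x.toKIdx U μ))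
    {W12 : MemberY θ.d₆ θ.ℓ₆ θ.hd' θ.hL' θ.b₀ θ.b₁ Mstar → Type} [∀ x, Fintype (W12 x)]
    (𝔬12 : ∀ x : MemberY θ.d₆ θ.ℓ₆ θ.hd' θ.hL' θ.b₀ θ.b₁ Mstar, B9Thm312Whole.Ops (geo9Y x) (bg9YR (Matrix (Fin N) (Fin N) ℂ) (specialUnitaryUnits (Fin N)) R₁ R₂ x) (XBK (TrIdx N) x.toKIdx) (XBK (TrIdx N) x.toKIdx) (XHK (TrIdx N) x.toKIdx) (W12 x)) (H12 : MemberY θ.d₆ θ.ℓ₆ θ.hd' θ.hL' θ.b₀ θ.b₁ Mstar → Prop) {J : Type} (f : J → MemberY θ.d₆ θ.ℓ₆ θ.hd' θ.hL' θ.b₀ θ.b₁ Mstar)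
    (bH13 : ∀ x : MemberY θ.d₆ θ.ℓ₆ θ.hd' θ.hL' θ.b₀ θ.b₁ Mstar, (bg9YR (Matrix (Fin N) (Fin N) ℂ) (specialUnitaryUnits (Fin N)) R₁ R₂ x).Cfg → BlockNorm (toB6 (geo9Y x) 1 (H12 x)) (W12 x → ℝ)) (θD12 r12 B12₀ δ12₀ δK12 σ12 ρ12 a12 M12 B12₃ δ12₃ ρ13 α12 κ13 : ℝ) (hθD12 : 0 ≤ θD12) (hr12 : 0 ≤ r12)
    (θ2₁₂ B12₂ ρf12 : ℝ) (θH12 Bh12 Bi12 Bq12 : ℝ → ℝ) (Bi2₁₂ : ℝ → ℝ → ℝ) (hθH12 : ∀ β, 0 ≤ β → β < 1 → 0 ≤ θH12 β) (hθ2₁₂ : 0 ≤ θ2₁₂) (hB12₂ : 0 ≤ B12₂) (hρf12 : 0 < ρf12) (hρf1 : ρf12 + σ12 ≤ (1 - α12) * ρ12)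
    (hρf2 : ρf12 + 2 * σ12 + α12 * ρ12 ≤ ρ12) (hBh12 : ∀ β, 0 ≤ β → β < 1 → 0 ≤ Bh12 β) (hBi12 : ∀ ε, 0 < ε → ε ≤ 1 → 0 ≤ Bi12 ε) (hBi2₁₂ : ∀ ε β, 0 < ε → ε ≤ 1 → 0 ≤ β → β < 1 → 0 ≤ Bi2₁₂ ε β) (hBq12 : ∀ β, 0 ≤ Bq12 β)
    (bHX12 : ∀ x : MemberY θ.d₆ θ.ℓ₆ θ.hd' θ.hL' θ.b₀ θ.b₁ Mstar, ℝ → BlockNorm (toB6 (geo9Y x) 1 (H12 x)) ((XBK (TrIdx N) x.toKIdx) → ℝ))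
    (hB12₀ : 0 ≤ B12₀) (hB12₃ : 0 ≤ B12₃) (hσ12 : 0 < σ12) (hρ12 : 0 < ρ12) (hρS12 : ρ12 ≤ δ12₀) (hρδ12 : ρ12 + 2 * σ12 ≤ δK12) (hρ₃12 : ρ12 + σ12 ≤ δ12₃) (ha12 : 0 < a12) (hM12 : 0 < M12) (hα12 : 0 < α12) (hα12' : α12 ≤ 1 / 2)
    (hκ13 : ∀ x U, (bH13 x U).κ ≤ κ13) (hρ13 : 0 < ρ13) (hρ13ρ : ρ13 + 5 * σ12 ≤ ρ12) (hσρ13 : 3 * σ12 < (1 - α12) * ρ13)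
    (B13₄ : ℝ) (BhD13 Bx13 Bd13 : ℝ → ℝ) (Br13 Bd2₁₃ : ℝ → ℝ → ℝ) (hB13₄ : 0 ≤ B13₄) (hBr13 : ∀ ε ε', 0 < ε' → ε' < 1 → ε' < ε → ε ≤ ε' + 1 → 0 ≤ Br13 ε ε') (hBhD13 : ∀ β, 0 ≤ β → β < 1 → 0 ≤ BhD13 β) (hBx13 : ∀ β, 0 ≤ β → β < 1 → 0 ≤ Bx13 β)
    (hBd13 : ∀ ε, 0 < ε → ε ≤ 1 → 0 ≤ Bd13 ε) (hBd2₁₃ : ∀ ε β, 0 < ε → ε ≤ 1 → 0 ≤ β → β < 1 → 0 ≤ Bd2₁₃ ε β) (bHW13 : ∀ x : MemberY θ.d₆ θ.ℓ₆ θ.hd' θ.hL' θ.b₀ θ.b₁ Mstar, (bg9YR (Matrix (Fin N) (Fin N) ℂ) (specialUnitaryUnits (Fin N)) R₁ R₂ x).Cfg → ℝ → BlockNorm (toB6 (geo9Y x) 1 (H12 x)) (W12 x → ℝ)) (hκW13 : ∀ x U ε, (bHW13 x U ε).κ ≤ κ13)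
    (Gp : ∀ x : MemberY θ.d₆ θ.ℓ₆ θ.hd' θ.hL' θ.b₀ θ.b₁ Mstar, (bg9YR (Matrix (Fin N) (Fin N) ℂ) (specialUnitaryUnits (Fin N)) R₁ R₂ x).Cfg → Module.End ℝ (W12 x → ℝ))
    (bXH : ∀ x : MemberY θ.d₆ θ.ℓ₆ θ.hd' θ.hL' θ.b₀ θ.b₁ Mstar, (bg9YR (Matrix (Fin N) (Fin N) ℂ) (specialUnitaryUnits (Fin N)) R₁ R₂ x).Cfg → BlockNorm (toB6 (geo9Y x) 1 (H12 x)) (XBK (TrIdx N) x.toKIdx → ℝ)) (hκX : ∀ x U, (bXH x U).κ ≤ κ13)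
    (hmodel12 : ∀ j : J, M12 ≤ (geo9Y (f j)).M → ∀ α₀ : ℝ, 0 < α₀ → (geo9Y (f j)).M * α₀ ≤ a12 → ∀ U : (bg9YR (Matrix (Fin N) (Fin N) ℂ) (specialUnitaryUnits (Fin N)) R₁ R₂ (f j)).Cfg, (bg9YR (Matrix (Fin N) (Fin N) ℂ) (specialUnitaryUnits (Fin N)) R₁ R₂ (f j)).Reg335 c α₀ U → (bg9YR (Matrix (Fin N) (Fin N) ℂ) (specialUnitaryUnits (Fin N)) R₁ R₂ (f j)).Reg336 c α₀ U → FormSmall (𝔬12 (f j)) (r12 * ((geo9Y (f j)).M * α₀)) U ∧ B9Thm312Whole.Identities (𝔬12 (f j)) U)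
    (hpinE : ∀ x : MemberY θ.d₆ θ.ℓ₆ θ.hd' θ.hL' θ.b₀ θ.b₁ Mstar, (𝔒 x).HasRWExp = HasRWExpOfOps (ops312RY (𝔬12 x)))
    (hpinH : ∀ x : MemberY θ.d₆ θ.ℓ₆ θ.hd' θ.hL' θ.b₀ θ.b₁ Mstar, (𝔒 x).HasRWExpH = HasRWExpHOfOps (ops312RY (𝔬12 x)))
    (hpinK : ∀ x : MemberY θ.d₆ θ.ℓ₆ θ.hd' θ.hL' θ.b₀ θ.b₁ Mstar, (𝔒 x).PosDefK = PosDefKOfOps (ops312RY (𝔬12 x)))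
    -- [CASCADE-K] the `rfl`-PINS of the ops object's Sect.-D kernel slots to the letters (node00-def-Y `opsYOfLetters`: `GD ∕ G₁ ∕ GG := kernelFamilyB … 𝔏.GD … 𝔏.parB`, `H ∕ H₁ := hKernelOfOp …`; `B9Eq3132NuReading.operatorLayerYS349Nu`: `QGQinv ∕ QG1Qinv := siteKernelOfOpNu … 𝔏.QGQinv …` with the (3.132) letters `QGQinvQY ∕ QG1QinvQY` of `Node00.OpsYSectDQ` at `(𝔮, 𝔮⋆, parS, GpPhysY parS, Δ2)`)
    (h𝔒GD : ∀ x : MemberY θ.d₆ θ.ℓ₆ θ.hd' θ.hL' θ.b₀ θ.b₁ Mstar, (𝔒 x).GD = kernelFamilyB x.toKIdx (bg9Y (Matrix (Fin N) (Fin N) ℂ) (specialUnitaryUnits (Fin N)) x) (fun U => U) (𝔏 x).GD (𝔏 x).parB) (h𝔒G₁ : ∀ x : MemberY θ.d₆ θ.ℓ₆ θ.hd' θ.hL' θ.b₀ θ.b₁ Mstar, (𝔒 x).G₁ = kernelFamilyB x.toKIdx (bg9Y (Matrix (Fin N) (Fin N) ℂ) (specialUnitaryUnits (Fin N)) x) (fun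 U => U) (𝔏 x).G₁ (𝔏 x).parB) (h𝔒GG : ∀ x : MemberY θ.d₆ θ.ℓ₆ θ.hd' θ.hL' θ.b₀ θ.b₁ Mstar, (𝔒 x).GG = kernelFamilyB x.toKIdx (bg9Y (Matrix (Fin N) (Fin N) ℂ) (specialUnitaryUnits (Fin N)) x) (fun U => U) (𝔏 x).GG (𝔏 x).parB)
    (h𝔒H : ∀ x : MemberY θ.d₆ θ.ℓ₆ θ.hd' θ.hL' θ.b₀ θ.b₁ Mstar, (𝔒 x).H = hKernelOfOp x.toKIdx (bg9Y (Matrix (Fin N) (Fin N) ℂ) (specialUnitaryUnits (Fin N)) x) (fun U => U) (𝔏 x).H (𝔏 x).parB) (h𝔒H₁ : ∀ x : MemberY θ.d₆ θ.ℓ₆ θ.hd' θ.hL' θ.b₀ θ.b₁ Mstar, (𝔒 x).H₁ = hKernelOfOp x.toKIdx (bg9Y (Matrix (Fin N) (Fin N) ℂ) (specialUnitaryUnits (Fin N)) x) (fun U => U) (𝔏 x).H₁ (𝔏 x).parB)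
    (h𝔒QGQ : ∀ x : MemberY θ.d₆ θ.ℓ₆ θ.hd' θ.hL' θ.b₀ θ.b₁ Mstar, (𝔒 x).QGQinv = siteKernelOfOpNu x.toKIdx (bg9Y (Matrix (Fin N) (Fin N) ℂ) (specialUnitaryUnits (Fin N)) x) (fun U => U) (nuY (θ.d₆ + 1) x.toKIdx) (QGQinvQY x.toKIdx (𝔮 x.toKIdx) (𝔮s x.toKIdx) (parS x.toKIdx) (GpPhysY x.toKIdx (parS x.toKIdx)))) (h𝔒QG1Q : ∀ x : MemberY θ.d₆ θ.ℓ₆ θ.hd' θ.hL' θ.b₀ θ.b₁ Mstar, (𝔒 x).QG1Qinv = siteKernelOfOpNu x.toKIdx (bg9Y (Matrix (Fin N) (Fin N) ℂ) (specialUnitaryUnits (Fin N)) x) (fun U => U) (nuY (θ.d₆ + 1) x.toKIdx) (QG1QinvQY x.toKIdx (𝔮 x.toKIdx) (𝔮s x.toKIdx) (parS x.toKIdx) (GpPhysY x.toKIdx (parS x.toKIdx)) (Δ2 x)))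
    -- PINS of Theorems 3.12–3.13's walk letters to the coordinate models of the GENUINE `GD G₁ GG` — the nine `CoRealizesRel` and nine `CoReadsGlob` co-readings are theorems
    (hblk12 : ∀ x : MemberY θ.d₆ θ.ℓ₆ θ.hd' θ.hL' θ.b₀ θ.b₁ Mstar, (𝔬12 x).blk = blkBK x.toKIdx (bI x)) (hblkY12 : ∀ x : MemberY θ.d₆ θ.ℓ₆ θ.hd' θ.hL' θ.b₀ θ.b₁ Mstar, (𝔬12 x).blkY = blkBK x.toKIdx (bI x))
    (hGco12 : ∀ (x : MemberY θ.d₆ θ.ℓ₆ θ.hd' θ.hL' θ.b₀ θ.b₁ Mstar) (U : (bg9YR (Matrix (Fin N) (Fin N) ℂ) (specialUnitaryUnits (Fin N)) R₁ R₂ x).Cfg), (𝔬12 x).G U = GcoK x.toKIdx (trBasis N) (bg9YR (Matrix (Fin N) (Fin N) ℂ) (specialUnitaryUnits (Fin N)) R₁ R₂ x) (fun U => U) (𝔏 x).GD U)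
    (hG1co12 : ∀ (x : MemberY θ.d₆ θ.ℓ₆ θ.hd' θ.hL' θ.b₀ θ.b₁ Mstar) (U : (bg9YR (Matrix (Fin N) (Fin N) ℂ) (specialUnitaryUnits (Fin N)) R₁ R₂ x).Cfg), (𝔬12 x).G1 U = GcoK x.toKIdx (trBasis N) (bg9YR (Matrix (Fin N) (Fin N) ℂ) (specialUnitaryUnits (Fin N)) R₁ R₂ x) (fun U => U) (𝔏 x).G₁ U)
    (hGGco12 : ∀ (x : MemberY θ.d₆ θ.ℓ₆ θ.hd' θ.hL' θ.b₀ θ.b₁ Mstar) (U : (bg9YR (Matrix (Fin N) (Fin N) ℂ) (specialUnitaryUnits (Fin N)) R₁ R₂ x).Cfg), (𝔬12 x).GG U = GcoK x.toKIdx (trBasis N) (bg9YR (Matrix (Fin N) (Fin N) ℂ) (specialUnitaryUnits (Fin N)) R₁ R₂ x) (fun U => U) (𝔏 x).GG U)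
    (hDco12 : ∀ (x : MemberY θ.d₆ θ.ℓ₆ θ.hd' θ.hL' θ.b₀ θ.b₁ Mstar) (U : (bg9YR (Matrix (Fin N) (Fin N) ℂ) (specialUnitaryUnits (Fin N)) R₁ R₂ x).Cfg), (𝔬12 x).D U = DcoK x.toKIdx (trBasis N) (bg9YR (Matrix (Fin N) (Fin N) ℂ) (specialUnitaryUnits (Fin N)) R₁ R₂ x) (fun U => U) U)
    (hDsco12 : ∀ (x : MemberY θ.d₆ θ.ℓ₆ θ.hd' θ.hL' θ.b₀ θ.b₁ Mstar) (U : (bg9YR (Matrix (Fin N) (Fin N) ℂ) (specialUnitaryUnits (Fin N)) R₁ R₂ x).Cfg), (𝔬12 x).Dstar U = DscoK x.toKIdx (trBasis N) (bg9YR (Matrix (Fin N) (Fin N) ℂ) (specialUnitaryUnits (Fin N)) R₁ R₂ x) (fun U => U) U)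
    (hblkZ12 : ∀ x : MemberY θ.d₆ θ.ℓ₆ θ.hd' θ.hL' θ.b₀ θ.b₁ Mstar, (𝔬12 x).blkZ = blkHK x.toKIdx)
    (hHm12 : ∀ (x : MemberY θ.d₆ θ.ℓ₆ θ.hd' θ.hL' θ.b₀ θ.b₁ Mstar) (U : (bg9YR (Matrix (Fin N) (Fin N) ℂ) (specialUnitaryUnits (Fin N)) R₁ R₂ x).Cfg), (𝔬12 x).Hm U = HcoK x.toKIdx (trBasis N) (bg9YR (Matrix (Fin N) (Fin N) ℂ) (specialUnitaryUnits (Fin N)) R₁ R₂ x) (fun U => U) (𝔏 x).H U)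
    (hH1m12 : ∀ (x : MemberY θ.d₆ θ.ℓ₆ θ.hd' θ.hL' θ.b₀ θ.b₁ Mstar) (U : (bg9YR (Matrix (Fin N) (Fin N) ℂ) (specialUnitaryUnits (Fin N)) R₁ R₂ x).Cfg), (𝔬12 x).H1m U = HcoK x.toKIdx (trBasis N) (bg9YR (Matrix (Fin N) (Fin N) ℂ) (specialUnitaryUnits (Fin N)) R₁ R₂ x) (fun U => U) (𝔏 x).H₁ U)
    -- row 20's Hölder ∕ input ∕ H-Hölder co-readings on the PAIR family through the bond-carrier probes `𝔭A` (one probe family per carrier), and Theorem 3.3 ∕ the perturbation step ∕ the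
    -- H-letters in n06-l's direction-indexed schemas at the pinned single-direction letters `Dd ∕ Dds` (printed-shape hypothesis schemas; nothing of print asserted)
    (hH1N : ∀ (x : MemberY θ.d₆ θ.ℓ₆ θ.hd' θ.hL' θ.b₀ θ.b₁ Mstar) (U : (bg9YR (Matrix (Fin N) (Fin N) ℂ) (specialUnitaryUnits (Fin N)) R₁ R₂ x).Cfg), H1ReadsNbr (kernelFamilyR R₁ R₂ (𝔒 x).GD) U (𝔭A x) (RelB x.toKIdx) 2 (𝔬12 x).blk (𝔬12 x).blkY (evBK x.toKIdx) (evBK x.toKIdx) ((𝔬12 x).D U ∘ₗ (𝔬12 x).G U) ((𝔬12 x).G U ∘ₗ (𝔬12 x).Dstar U) ∧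
      H1ReadsNbr (kernelFamilyR R₁ R₂ (𝔒 x).G₁) U (𝔭A x) (RelB x.toKIdx) 2 (𝔬12 x).blk (𝔬12 x).blkY (evBK x.toKIdx) (evBK x.toKIdx) ((𝔬12 x).D U ∘ₗ (𝔬12 x).G1 U) ((𝔬12 x).G1 U ∘ₗ (𝔬12 x).Dstar U) ∧
      H1ReadsNbr (kernelFamilyR R₁ R₂ (𝔒 x).GG) U (𝔭A x) (RelB x.toKIdx) 2 (𝔬12 x).blk (𝔬12 x).blkY (evBK x.toKIdx) (evBK x.toKIdx) ((𝔬12 x).D U ∘ₗ (𝔬12 x).GG U) ((𝔬12 x).GG U ∘ₗ (𝔬12 x).Dstar U))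
    (hIF : ∀ (x : MemberY θ.d₆ θ.ℓ₆ θ.hd' θ.hL' θ.b₀ θ.b₁ Mstar) (U : (bg9YR (Matrix (Fin N) (Fin N) ℂ) (specialUnitaryUnits (Fin N)) R₁ R₂ x).Cfg), InputReadsFam (kernelFamilyR R₁ R₂ (𝔒 x).GD) U (bHX12 x) 2 ((𝔬12 x).blk ∘ Prod.fst) ((𝔭A x).blkPX ∘ Prod.fst) (fun β => sliceProbe ((𝔭A x).ΦX U β)) (evBK x.toKIdx) (familyOp fun q : Fin (θ.d₆ + 1) × Fin (θ.d₆ + 1) => (Dd x) U q.1 ∘ₗ ((𝔬12 x).G U ∘ₗ (Dds x) U q.2)) ∧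
      InputReadsFam (kernelFamilyR R₁ R₂ (𝔒 x).G₁) U (bHX12 x) 2 ((𝔬12 x).blk ∘ Prod.fst) ((𝔭A x).blkPX ∘ Prod.fst) (fun β => sliceProbe ((𝔭A x).ΦX U β)) (evBK x.toKIdx) (familyOp fun q : Fin (θ.d₆ + 1) × Fin (θ.d₆ + 1) => (Dd x) U q.1 ∘ₗ ((𝔬12 x).G1 U ∘ₗ (Dds x) U q.2)) ∧
      InputReadsFam (kernelFamilyR R₁ R₂ (𝔒 x).GG) U (bHX12 x) 2 ((𝔬12 x).blk ∘ Prod.fst) ((𝔭A x).blkPX ∘ Prod.fst) (fun β => sliceProbe ((𝔭A x).ΦX U β)) (evBK x.toKIdx) (familyOp fun q : Fin (θ.d₆ + 1) × Fin (θ.d₆ + 1) => (Dd x) U q.1 ∘ₗ ((𝔬12 x).GG U ∘ₗ (Dds x) U q.2)))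
    (hHCN : ∀ (x : MemberY θ.d₆ θ.ℓ₆ θ.hd' θ.hL' θ.b₀ θ.b₁ Mstar) (U : (bg9YR (Matrix (Fin N) (Fin N) ℂ) (specialUnitaryUnits (Fin N)) R₁ R₂ x).Cfg), CoReadsHHolderNbr (hKernelR R₁ R₂ (𝔒 x).H) U (θ.d₆ + 1) (𝔭A x) 2 (𝔬12 x).blkZ ((𝔬12 x).D U ∘ₗ (𝔬12 x).Hm U) ∧ CoReadsHHolderNbr (hKernelR R₁ R₂ (𝔒 x).H₁) U (θ.d₆ + 1) (𝔭A x) 2 (𝔬12 x).blkZ ((𝔬12 x).D U ∘ₗ (𝔬12 x).H1m U))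
    (hsymD : ∀ x : MemberY θ.d₆ θ.ℓ₆ θ.hd' θ.hL' θ.b₀ θ.b₁ Mstar, M12 ≤ (geo9Y x).M → ∀ α₀ : ℝ, 0 < α₀ → (geo9Y x).M * α₀ ≤ a12 → ∀ U : (bg9YR (Matrix (Fin N) (Fin N) ℂ) (specialUnitaryUnits (Fin N)) R₁ R₂ x).Cfg, (bg9YR (Matrix (Fin N) (Fin N) ℂ) (specialUnitaryUnits (Fin N)) R₁ R₂ x).Reg335 c α₀ U → IsSymmTr (fun _ => (1 : ℝ)) ((𝔏 x).GD U) ∧ IsSymmTr (fun _ => (1 : ℝ)) ((𝔏 x).G₁ U) ∧ IsSymmTr (fun _ => (1 : ℝ)) ((𝔏 x).GG U))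
    (hG0C : ∀ x : MemberY θ.d₆ θ.ℓ₆ θ.hd' θ.hL' θ.b₀ θ.b₁ Mstar, M12 ≤ (geo9Y x).M → ∀ α₀ : ℝ, 0 < α₀ → (geo9Y x).M * α₀ ≤ a12 → ∀ U : (bg9YR (Matrix (Fin N) (Fin N) ℂ) (specialUnitaryUnits (Fin N)) R₁ R₂ x).Cfg, (bg9YR (Matrix (Fin N) (Fin N) ℂ) (specialUnitaryUnits (Fin N)) R₁ R₂ x).Reg335 c α₀ U → (bg9YR (Matrix (Fin N) (Fin N) ℂ) (specialUnitaryUnits (Fin N)) R₁ R₂ x).Reg336 c α₀ U →  Thm33G0Dir (𝔬12 x) (𝔭A x) (Dd x) (Dds x) 1 (H12 x) (bHX12 x) B12₀ Bh12 Bi12 Bi2₁₂ δ12₀ U ∧ Thm33G0DirR (𝔬12 x) (Dds x) 1 (H12 x) B12₀ δ12₀ U ∧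
      Thm33G0L2M (𝔬12 x) (Dd x) (Dds x) 1 (H12 x) B12₂ δ12₀ U)
    (hStL : ∀ j : J, M12 ≤ (geo9Y (f j)).M → ∀ α₀ : ℝ, 0 < α₀ → (geo9Y (f j)).M * α₀ ≤ a12 → ∀ U : (bg9YR (Matrix (Fin N) (Fin N) ℂ) (specialUnitaryUnits (Fin N)) R₁ R₂ (f j)).Cfg, (bg9YR (Matrix (Fin N) (Fin N) ℂ) (specialUnitaryUnits (Fin N)) R₁ R₂ (f j)).Reg335 c α₀ U → (bg9YR (Matrix (Fin N) (Fin N) ℂ) (specialUnitaryUnits (Fin N)) R₁ R₂ (f j)).Reg336 c α₀ U →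
  StepL2 (𝔬12 (f j)) 1 (H12 (f j)) (θ2₁₂ * ((geo9Y (f j)).M * α₀)) δK12 U)
    (hLHH : ∀ x : MemberY θ.d₆ θ.ℓ₆ θ.hd' θ.hL' θ.b₀ θ.b₁ Mstar, M12 ≤ (geo9Y x).M → ∀ α₀ : ℝ, 0 < α₀ → (geo9Y x).M * α₀ ≤ a12 → ∀ U : (bg9YR (Matrix (Fin N) (Fin N) ℂ) (specialUnitaryUnits (Fin N)) R₁ R₂ x).Cfg, (bg9YR (Matrix (Fin N) (Fin N) ℂ) (specialUnitaryUnits (Fin N)) R₁ R₂ x).Reg335 c α₀ U → (bg9YR (Matrix (Fin N) (Fin N) ℂ) (specialUnitaryUnits (Fin N)) R₁ R₂ x).Reg336 c α₀ U →  LettersHHZ (𝔬12 x) (𝔭A x) 1 (H12 x) (fun y => (geo9Y_len_pos x y).le) (weightNorm (BlockNorm.ofBlocks (toB6 (geo9Y x) 1 (H12 x)) (𝔬12 x).blkZ) (fun y => ((((θ.ℓ₆ + 1 : ℕ) : ℝ) ^ (θ.d₆ + 1)) ^ lvl x.hN x.D x.hk y)⁻¹) (fun y => (plateau_pos x.toKIdx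 y).le)) Bq12 δ12₃ U)
    (hLH3 : ∀ j : J, M12 ≤ (geo9Y (f j)).M → ∀ α₀ : ℝ, 0 < α₀ → (geo9Y (f j)).M * α₀ ≤ a12 → ∀ U : (bg9YR (Matrix (Fin N) (Fin N) ℂ) (specialUnitaryUnits (Fin N)) R₁ R₂ (f j)).Cfg, (bg9YR (Matrix (Fin N) (Fin N) ℂ) (specialUnitaryUnits (Fin N)) R₁ R₂ (f j)).Reg335 c α₀ U → (bg9YR (Matrix (Fin N) (Fin N) ℂ) (specialUnitaryUnits (Fin N)) R₁ R₂ (f j)).Reg336 c α₀ U → Letters313HZc (𝔬12 (f j)) (𝔭A (f j)) (Gp (f j)) 1 (H12 (f j)) ⟨geo9Y_dist_triangle (f j), geo9Y_dist_comm (f j), geo9K_dist_nonneg (f j).toKIdx, geo9Y_len_pos (f j)⟩ (fun y => ((((θ.ℓ₆ + 1 : ℕ) : ℝ) ^ (θ.d₆ + 1)) ^ lvl (f j).hN (f j).D (f j).hk y)⁻¹) (fun y => plateau_pos (f j).toKIdx y) (bH13 (f j) U) BhD13 Bx13 δ12₃ (bXH (f j) U) U)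
    -- face v1.6 (dag-n06-d LOCATED-c1): the block-L² pair record WITHOUT its `c1` field — the pair letters as a FUNCTION of `c1`, monotone in the letters (B′ ≥ B13₄, δ′ ≤ δ12₃), at the L² weight v_Z = √n⁻¹;
    -- `c1` itself is DERIVED inside (row 26 → `zletters_of_pins` conjunct 5 → dag-n06-c's `c1L2_of_pinsR`); the direction letters as before
    (hLL2 : ∀ j : J, M12 ≤ (geo9Y (f j)).M → ∀ α₀ : ℝ, 0 < α₀ → (geo9Y (f j)).M * α₀ ≤ a12 → ∀ U : (bg9YR (Matrix (Fin N) (Fin N) ℂ) (specialUnitaryUnits (Fin N)) R₁ R₂ (f j)).Cfg, (bg9YR (Matrix (Fin N) (Fin N) ℂ) (specialUnitaryUnits (Fin N)) R₁ R₂ (f j)).Reg335 c α₀ U → (bg9YR (Matrix (Fin N) (Fin N) ℂ) (specialUnitaryUnits (Fin N)) R₁ R₂ (f j)).Reg336 c α₀ U → (∀ B' δ' : ℝ, B13₄ ≤ B' → δ' ≤ δ12₃ → B9SectDL2Decay.BlockBd (g := toB6 (geo9Y (f j)) 1 (H12 (f j))) (𝔬12 (f j)).blkZ (𝔬12 (f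 j)).blkZ ((𝔬12 (f j)).C1 U) (fun (y y' : (geo9Y (f j)).Site) => B' * (Real.sqrt ((((θ.ℓ₆ + 1 : ℕ) : ℝ) ^ (θ.d₆ + 1)) ^ lvl (f j).hN (f j).D (f j).hk y)⁻¹ * (geo9Y (f j)).len y)⁻¹ * (Real.sqrt ((((θ.ℓ₆ + 1 : ℕ) : ℝ) ^ (θ.d₆ + 1)) ^ lvl (f j).hN (f j).D (f j).hk y')⁻¹ * (geo9Y (f j)).len y')⁻¹ * Real.exp (-(δ' * (geo9Y (f j)).dist y y'))) →
        Letters313L2Pc (𝔬12 (f j)) (Dd (f j)) (Dds (f j)) 1 (H12 (f j)) B' δ' (fun y => Real.sqrt ((((θ.ℓ₆ + 1 : ℕ) : ℝ) ^ (θ.d₆ + 1)) ^ lvl (f j).hN (f j).D (f j).hk y)⁻¹) (fun y => Real.sqrt_pos.2 (plateau_pos (f j).toKIdx y)) U) ∧ Letters313L2MZ (𝔬12 (f j)) (Dd (f j)) (Dds (f j)) 1 (H12 (f j)) B13₄ δ12₃ (fun y => Real.sqrt ((((θ.ℓ₆ + 1 : ℕ) : ℝ) ^ (θ.d₆ + 1))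 ^ lvl (f j).hN (f j).D (f j).hk y)⁻¹) (fun y => Real.sqrt_pos.2 (plateau_pos (f j).toKIdx y)) U)
    -- the (3.152)–(3.153) input letters FIELD-WISE (dag-n06-l P-U8S″: no `Letters313IMBC` record, hence no right form `tDv` and no θ_V letter)
    (hrgdd13 : ∀ j : J, M12 ≤ (geo9Y (f j)).M → ∀ α₀ : ℝ, 0 < α₀ → (geo9Y (f j)).M * α₀ ≤ a12 → ∀ U : (bg9YR (Matrix (Fin N) (Fin N) ℂ) (specialUnitaryUnits (Fin N)) R₁ R₂ (f j)).Cfg, (bg9YR (Matrix (Fin N) (Fin N) ℂ) (specialUnitaryUnits (Fin N)) R₁ R₂ (f j)).Reg335 c α₀ U → (bg9YR (Matrix (Fin N) (Fin N) ℂ) (specialUnitaryUnits (Fin N)) R₁ R₂ (f j)).Reg336 c α₀ U →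
        ∀ (μ : Fin (θ.d₆ + 1)) (ε ε' : ℝ), 0 < ε' → ε' < 1 → ε' < ε → ε ≤ ε' + 1 →
          HasMaj (bHX12 (f j) ε) (bHW13 (f j) U ε') ((𝔬12 (f j)).R U ∘ₗ (𝔬12 (f j)).Dvstar U ∘ₗ (𝔬12 (f j)).G1 U ∘ₗ Dds (f j) U μ) (fun a b => Br13 ε ε' * Real.exp (-(δ12₃ * (geo9Y (f j)).dist a b))))
    (hdgDvd13 : ∀ x : MemberY θ.d₆ θ.ℓ₆ θ.hd' θ.hL' θ.b₀ θ.b₁ Mstar, M12 ≤ (geo9Y x).M → ∀ α₀ : ℝ, 0 < α₀ → (geo9Y x).M * α₀ ≤ a12 → ∀ U : (bg9YR (Matrix (Fin N) (Fin N) ℂ) (specialUnitaryUnits (Fin N)) R₁ R₂ x).Cfg, (bg9YR (Matrix (Fin N) (Fin N) ℂ) (specialUnitaryUnits (Fin N)) R₁ R₂ x).Reg335 c α₀ U → (bg9YR (Matrix (Fin N) (Fin N) ℂ) (specialUnitaryUnits (Fin N)) R₁ R₂ x).Reg336 c α₀ U →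
        ∀ (ν : Fin (θ.d₆ + 1)) (ε : ℝ), 0 < ε → ε ≤ 1 → HasMaj (bHW13 x U ε) (BlockNorm.ofBlocks (toB6 (geo9Y x) 1 (H12 x)) (𝔬12 x).blk)
          (Dd x U ν ∘ₗ ((𝔬12 x).G0 U ∘ₗ (𝔬12 x).Dv U)) (fun (a b : (geo9Y x).Site) => Bd13 ε * Real.exp (-(δ12₃ * (geo9Y x).dist a b))))
    (hpdgDvd13 : ∀ x : MemberY θ.d₆ θ.ℓ₆ θ.hd' θ.hL' θ.b₀ θ.b₁ Mstar, M12 ≤ (geo9Y x).M → ∀ α₀ : ℝ, 0 < α₀ → (geo9Y x).M * α₀ ≤ a12 → ∀ U : (bg9YR (Matrix (Fin N) (Fin N) ℂ) (specialUnitaryUnits (Fin N)) R₁ R₂ x).Cfg, (bg9YR (Matrix (Fin N) (Fin N) ℂ) (specialUnitaryUnits (Fin N)) R₁ R₂ x).Reg335 c α₀ U → (bg9YR (Matrix (Fin N) (Fin N) ℂ) (specialUnitaryUnits (Fin N)) R₁ R₂ x).Reg336 c α₀ U →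
        ∀ (ν : Fin (θ.d₆ + 1)) (ε β : ℝ), 0 < ε → ε ≤ 1 → 0 ≤ β → β < 1 →
          HasMaj (bHW13 x U (β + ε)) (BlockNorm.ofBlocks (toB6 (geo9Y x) 1 (H12 x)) (𝔭A x).blkPX)
            (((𝔭A x).ΦX U β ∘ₗ Dd x U ν) ∘ₗ ((𝔬12 x).G0 U ∘ₗ (𝔬12 x).Dv U))
            (fun (a b : (geo9Y x).Site) => Bd2₁₃ ε β * (geo9Y x).len a ^ (-β) * Real.exp (-(δ12₃ * (geo9Y x).dist a b))))
    -- face v1.5: the TWO displayed Z-letters gD2 gQs1; gQs2 ∕ dgQs from the G₀ layer (`hG0e`, `he1`), c2 ∕ c12 ∕ c1_2 ∕ c1_1 from ROW 26 (`h26`), rgd2 := `hrgd2_13`, q2 q1 from the pin `hQco12`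
    (hZ2 : ∀ x : MemberY θ.d₆ θ.ℓ₆ θ.hd' θ.hL' θ.b₀ θ.b₁ Mstar, M12 ≤ (geo9Y x).M → ∀ α₀ : ℝ, 0 < α₀ → (geo9Y x).M * α₀ ≤ a12 → ∀ U : (bg9YR (Matrix (Fin N) (Fin N) ℂ) (specialUnitaryUnits (Fin N)) R₁ R₂ x).Cfg, (bg9YR (Matrix (Fin N) (Fin N) ℂ) (specialUnitaryUnits (Fin N)) R₁ R₂ x).Reg335 c α₀ U → (bg9YR (Matrix (Fin N) (Fin N) ℂ) (specialUnitaryUnits (Fin N)) R₁ R₂ x).Reg336 c α₀ U →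
        HasMaj (cNorm 1 (H12 x) (𝔬12 x).blkW (fun y => (geo9Y_len_pos x y).le) 1) (cNorm 1 (H12 x) (𝔬12 x).blk (fun y => (geo9Y_len_pos x y).le) 2) ((𝔬12 x).G0 U ∘ₗ (𝔬12 x).Dv U) (fun a b => B12₃ * Real.exp (-(δ12₃ * (geo9Y x).dist a b))) ∧
        HasMaj (weightNorm (BlockNorm.ofBlocks (toB6 (geo9Y x) 1 (H12 x)) (𝔬12 x).blkZ) (fun y => (geo9Y x).len y * ((((θ.ℓ₆ + 1 : ℕ) : ℝ) ^ (θ.d₆ + 1)) ^ lvl x.hN x.D x.hk y)⁻¹) fun y => (mul_pos (geo9Y_len_pos x y) (plateau_pos x.toKIdx y)).le) (cNorm 1 (H12 x) (𝔬12 x).blk (fun y => (geo9Y_len_pos x y).le) 1) ((𝔬12 x).G0 U ∘ₗ (𝔬12 x).Qstar U) (fun a b => B12₃ * Real.exp (-(δ12₃ * (geo9Y x).dist a b))))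
    -- face v1.5 (P-DISP 3): the pins of Q\*, C, C₁ (the certificate's `hQsco12 hCco12 hC1co12`), the G₀ sup letter (its `(hmodel12 …).1`), ROW 26 as it holds it (`h26 := s3132`)
    (hCco12 : ∀ (x : MemberY θ.d₆ θ.ℓ₆ θ.hd' θ.hL' θ.b₀ θ.b₁ Mstar) (U : (bg9YR (Matrix (Fin N) (Fin N) ℂ) (specialUnitaryUnits (Fin N)) R₁ R₂ x).Cfg), (𝔬12 x).C U = CcoKq x.toKIdx (trBasis N) (bg9YR (Matrix (Fin N) (Fin N) ℂ) (specialUnitaryUnits (Fin N)) R₁ R₂ x) (fun U => U) (𝔮 x.toKIdx) (𝔮s x.toKIdx) (parS x.toKIdx) (GpPhysY x.toKIdx (parS x.toKIdx)) U)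
    (hC1co12 : ∀ (x : MemberY θ.d₆ θ.ℓ₆ θ.hd' θ.hL' θ.b₀ θ.b₁ Mstar) (U : (bg9YR (Matrix (Fin N) (Fin N) ℂ) (specialUnitaryUnits (Fin N)) R₁ R₂ x).Cfg), (𝔬12 x).C1 U = C1coKq x.toKIdx (trBasis N) (bg9YR (Matrix (Fin N) (Fin N) ℂ) (specialUnitaryUnits (Fin N)) R₁ R₂ x) (fun U => U) (𝔮 x.toKIdx) (𝔮s x.toKIdx) (parS x.toKIdx) (GpPhysY x.toKIdx (parS x.toKIdx)) (Δ2 x) U)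
    -- [CASCADE-K] LAW: `C₁(U)` is its own counting transpose on the member classes (3.35)–(3.36) (today: dag-n06-w5 `isTransposePair_C1coK` + def-Y `G1Y_GpPhysY_isSymmTr_parSymY`; knit: the adjoint law of the knit pair + G₁ symmetric at `parKnitY`)
    (hC1T : ∀ x : MemberY θ.d₆ θ.ℓ₆ θ.hd' θ.hL' θ.b₀ θ.b₁ Mstar, M12 ≤ (geo9Y x).M → ∀ α₀ : ℝ, 0 < α₀ → (geo9Y x).M * α₀ ≤ a12 → ∀ U : (bg9YR (Matrix (Fin N) (Fin N) ℂ) (specialUnitaryUnits (Fin N)) R₁ R₂ x).Cfg, (bg9YR (Matrix (Fin N) (Fin N) ℂ) (specialUnitaryUnits (Fin N)) R₁ R₂ x).Reg335 c α₀ U → (bg9YR (Matrix (Fin N) (Fin N) ℂ) (specialUnitaryUnits (Fin N)) R₁ R₂ x).Reg336 c α₀ U → IsTransposePair ((𝔬12 x).C1 U) ((𝔬12 x).C1 U))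
    (hG0e : ∀ x : MemberY θ.d₆ θ.ℓ₆ θ.hd' θ.hL' θ.b₀ θ.b₁ Mstar, M12 ≤ (geo9Y x).M → ∀ α₀ : ℝ, 0 < α₀ → (geo9Y x).M * α₀ ≤ a12 → ∀ U : (bg9YR (Matrix (Fin N) (Fin N) ℂ) (specialUnitaryUnits (Fin N)) R₁ R₂ x).Cfg, (bg9YR (Matrix (Fin N) (Fin N) ℂ) (specialUnitaryUnits (Fin N)) R₁ R₂ x).Reg335 c α₀ U → (bg9YR (Matrix (Fin N) (Fin N) ℂ) (specialUnitaryUnits (Fin N)) R₁ R₂ x).Reg336 c α₀ U → Thm33G0 (𝔬12 x) 1 (H12 x) B12₀ δ12₀ U)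
    (hδ₃₀ : δ12₃ ≤ δ12₀)
    -- [CASCADE-K] ROW 26 AS THE KNIT CERTIFICATE DISPLAYS IT (`…KnitPairKA`'s `s3132K` verbatim with `𝔒` for the instance)
    (h26 : B9.Stmt3132Printed (θ.d₆ + 1) c (fun j : J => geo9Y (f j)) (fun j : J => bg9YR (Matrix (Fin N) (Fin N) ℂ) (specialUnitaryUnits (Fin N)) R₁ R₂ (f j)) (fun j => siteKernelR R₁ R₂ (𝔒 (f j)).QGQinv) (fun j => siteKernelR R₁ R₂ (𝔒 (f j)).QG1Qinv))
    -- [CASCADE-K] LAW: THE AVERAGING LETTER's `Q`-LETTERS AT THE MemberY θ.d₆ θ.ℓ₆ θ.hd' θ.hL' θ.b₀ θ.b₁ MstarBER (v1.7: the pin `hQco12 : Q = QcoKH … parBY` + the (2.60) numerics `hM12q hB12₃q` through dag-n06-w5's `hasMaj_Q_of_pins`; knit: dag-n06-c's (L7) sizes)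
    (BQp : ℝ) (hBQp : 0 ≤ BQp) (hqK : ∀ x : MemberY θ.d₆ θ.ℓ₆ θ.hd' θ.hL' θ.b₀ θ.b₁ Mstar, M12 ≤ (geo9Y x).M → ∀ α₀ : ℝ, 0 < α₀ → (geo9Y x).M * α₀ ≤ a12 → ∀ U : (bg9YR (Matrix (Fin N) (Fin N) ℂ) (specialUnitaryUnits (Fin N)) R₁ R₂ x).Cfg, (bg9YR (Matrix (Fin N) (Fin N) ℂ) (specialUnitaryUnits (Fin N)) R₁ R₂ x).Reg335 c α₀ U →
      ∀ p : ℕ, p ≤ 2 → HasMaj (cNorm 1 (H12 x) (𝔬12 x).blk (fun y => (geo9Y_len_pos x y).le) p) (cNorm 1 (H12 x) (𝔬12 x).blkZ (fun y => (geo9Y_len_pos x y).le) p) ((𝔬12 x).Q U) (fun a b => BQp * Real.exp (-(δ12₃ * (geo9Y x).dist a b))))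
    -- [CASCADE-K] LAW: THE AVERAGING LETTER's `Q⋆`-MAJORANT AT THE MemberY θ.d₆ θ.ℓ₆ θ.hd' θ.hL' θ.b₀ θ.b₁ MstarBER (v1.7: the pin `hQsco12 : Q⋆ = QscoKH … parBY` through w5's `gQs2_pinsB ∕ dgQs_pinsB`; the law of `…N06G0QstarLettersLegAtPinsPUPar`, same shape)
    (BQ δQ : ℝ) (hBQ : 0 ≤ BQ) (hδQ : δ12₃ + σ12 ≤ δQ) (hqsK : ∀ x : MemberY θ.d₆ θ.ℓ₆ θ.hd' θ.hL' θ.b₀ θ.b₁ Mstar, M12 ≤ (geo9Y x).M → ∀ α₀ : ℝ, 0 < α₀ → (geo9Y x).M * α₀ ≤ a12 → ∀ U : (bg9YR (Matrix (Fin N) (Fin N) ℂ) (specialUnitaryUnits (Fin N)) R₁ R₂ x).Cfg, (bg9YR (Matrix (Fin N) (Fin N) ℂ) (specialUnitaryUnits (Fin N)) R₁ R₂ x).Reg335 c α₀ U →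
      HasMaj (weightNorm (BlockNorm.ofBlocks (toB6 (geo9Y x) 1 (H12 x)) (𝔬12 x).blkZ) (fun y => ((((θ.ℓ₆ + 1 : ℕ) : ℝ) ^ (θ.d₆ + 1)) ^ lvl x.hN x.D x.hk y)⁻¹) (fun y => (plateau_pos x.toKIdx y).le)) (cNorm 1 (H12 x) (𝔬12 x).blk (fun y => (geo9Y_len_pos x y).le) 0) ((𝔬12 x).Qstar U) (fun a a' => BQ * Real.exp (-(δQ * (geo9Y x).dist a a'))))
    -- the letter `rgd2` (R∇\*_UG₁ : 𝔠⁽⁰⁾ → 𝔠_W⁽¹⁾) DERIVED by the certificate (dag-n06-l `…N06Rgd2LegAtPinsPhysPU.hrgd2_of_pinsP_geo9Y` + its own `Ids3152`), no longer displayed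
    (hrgd2_13 : ∀ j : J, M12 ≤ (geo9Y (f j)).M → ∀ α₀ : ℝ, 0 < α₀ → (geo9Y (f j)).M * α₀ ≤ a12 → ∀ U : (bg9YR (Matrix (Fin N) (Fin N) ℂ) (specialUnitaryUnits (Fin N)) R₁ R₂ (f j)).Cfg, (bg9YR (Matrix (Fin N) (Fin N) ℂ) (specialUnitaryUnits (Fin N)) R₁ R₂ (f j)).Reg335 c α₀ U → (bg9YR (Matrix (Fin N) (Fin N) ℂ) (specialUnitaryUnits (Fin N)) R₁ R₂ (f j)).Reg336 c α₀ U →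
        HasMaj (cNorm 1 (H12 (f j)) (𝔬12 (f j)).blk (fun y => (geo9Y_len_pos (f j) y).le) 0) (cNorm 1 (H12 (f j)) (𝔬12 (f j)).blkW (fun y => (geo9Y_len_pos (f j) y).le) 1) ((𝔬12 (f j)).R U ∘ₗ (𝔬12 (f j)).Dvstar U ∘ₗ (𝔬12 (f j)).G1 U ∘ₗ LinearMap.id) (fun a b => B12₃ * Real.exp (-(δ12₃ * (geo9Y (f j)).dist a b))))
    (hwGp13 : ∀ j : J, M12 ≤ (geo9Y (f j)).M → ∀ α₀ : ℝ, 0 < α₀ → (geo9Y (f j)).M * α₀ ≤ a12 → ∀ U : (bg9YR (Matrix (Fin N) (Fin N) ℂ) (specialUnitaryUnits (Fin N)) R₁ R₂ (f j)).Cfg, (bg9YR (Matrix (Fin N) (Fin N) ℂ) (specialUnitaryUnits (Fin N)) R₁ R₂ (f j)).Reg335 c α₀ U → (bg9YR (Matrix (Fin N) (Fin N) ℂ) (specialUnitaryUnits (Fin N)) R₁ R₂ (f j)).Reg336 c α₀ U →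
        HasMaj (bXH (f j) U) (cNorm 1 (H12 (f j)) (𝔬12 (f j)).blk (fun y => (geo9Y_len_pos (f j) y).le) 1) ((𝔬12 (f j)).Dv U ∘ₗ Gp (f j) U ∘ₗ (𝔬12 (f j)).R U ∘ₗ (𝔬12 (f j)).Dvstar U) (fun a b => B12₃ * Real.exp (-(δ12₃ * (geo9Y (f j)).dist a b))))
    (h152 : ∀ j : J, M12 ≤ (geo9Y (f j)).M → ∀ α₀ : ℝ, 0 < α₀ → (geo9Y (f j)).M * α₀ ≤ a12 → ∀ U : (bg9YR (Matrix (Fin N) (Fin N) ℂ) (specialUnitaryUnits (Fin N)) R₁ R₂ (f j)).Cfg, (bg9YR (Matrix (Fin N) (Fin N) ℂ) (specialUnitaryUnits (Fin N)) R₁ R₂ (f j)).Reg335 c α₀ U → (bg9YR (Matrix (Fin N) (Fin N) ℂ) (specialUnitaryUnits (Fin N)) R₁ R₂ (f j)).Reg336 c α₀ U → Ids3152 (𝔬12 (f j)) (Gp (f j)) U)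
    (hrgdH13 : ∀ j : J, M12 ≤ (geo9Y (f j)).M → ∀ α₀ : ℝ, 0 < α₀ → (geo9Y (f j)).M * α₀ ≤ a12 → ∀ U : (bg9YR (Matrix (Fin N) (Fin N) ℂ) (specialUnitaryUnits (Fin N)) R₁ R₂ (f j)).Cfg, (bg9YR (Matrix (Fin N) (Fin N) ℂ) (specialUnitaryUnits (Fin N)) R₁ R₂ (f j)).Reg335 c α₀ U → (bg9YR (Matrix (Fin N) (Fin N) ℂ) (specialUnitaryUnits (Fin N)) R₁ R₂ (f j)).Reg336 c α₀ U → HasMaj (cNorm 1 (H12 (f j)) (𝔬12 (f j)).blk (fun y => (geo9Y_len_pos (f j) y).le) 0) (bH13 (f j) U) ((𝔬12 (f j)).R U ∘ₗ (𝔬12 (f j)).Dvstar U ∘ₗ (𝔬12 (f j)).G1 U ∘ₗ LinearMap.id) (fun a b => B12₃ * Real.exp (-(δ12₃ * (geo9Y (f j)).dist a b))))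
    (hdgDH13 : ∀ x : MemberY θ.d₆ θ.ℓ₆ θ.hd' θ.hL' θ.b₀ θ.b₁ Mstar, M12 ≤ (geo9Y x).M → ∀ α₀ : ℝ, 0 < α₀ → (geo9Y x).M * α₀ ≤ a12 → ∀ U : (bg9YR (Matrix (Fin N) (Fin N) ℂ) (specialUnitaryUnits (Fin N)) R₁ R₂ x).Cfg, (bg9YR (Matrix (Fin N) (Fin N) ℂ) (specialUnitaryUnits (Fin N)) R₁ R₂ x).Reg335 c α₀ U → (bg9YR (Matrix (Fin N) (Fin N) ℂ) (specialUnitaryUnits (Fin N)) R₁ R₂ x).Reg336 c α₀ U → HasMaj (bH13 x U) (cNorm 1 (H12 x) (𝔬12 x).blkY (fun y => (geo9Y_len_pos x y).le) 1) ((𝔬12 x).D U ∘ₗ (𝔬12 x).G0 U ∘ₗ (𝔬12 x).Dv U) (fun a b => B12₃ * Real.exp (-(δ12₃ * (geo9Y x).dist a b))))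
    (hlettersDM13 : ∀ x : MemberY θ.d₆ θ.ℓ₆ θ.hd' θ.hL' θ.b₀ θ.b₁ Mstar, M12 ≤ (geo9Y x).M → ∀ α₀ : ℝ, 0 < α₀ → (geo9Y x).M * α₀ ≤ a12 → ∀ U : (bg9YR (Matrix (Fin N) (Fin N) ℂ) (specialUnitaryUnits (Fin N)) R₁ R₂ x).Cfg, (bg9YR (Matrix (Fin N) (Fin N) ℂ) (specialUnitaryUnits (Fin N)) R₁ R₂ x).Reg335 c α₀ U → (bg9YR (Matrix (Fin N) (Fin N) ℂ) (specialUnitaryUnits (Fin N)) R₁ R₂ x).Reg336 c α₀ U → Letters313DMZ (𝔬12 x) (𝔭A x) (Dd x) 1 (H12 x) ⟨geo9Y_dist_triangle x, geo9Y_dist_comm x, geo9K_dist_nonneg x.toKIdx, geo9Y_len_pos x⟩ (fun y => ((((θ.ℓ₆ + 1 : ℕ) : ℝ) ^ (θ.d₆ + 1)) ^ lvl x.hN x.D x.hk y)⁻¹) (fun y => plateau_pos x.toKIdx y) B12₃ Bq12 δ12₃ (bH13 x U) U)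
    -- U8 (director-ym №272 (5)): the regular state classes' letters, the (3.43) homogeneous majorant, the ℓ¹ input controls (№285 (R-b)) and the four STATE TUPLES replacing the raw Δ⁽²⁾ letters
    (θS κS A₀S AW AQ AD AQ1 CR δP : ℝ) (AI AV : ℝ → ℝ) (hθS : 0 ≤ θS) (hκS : 1 ≤ κS) (hκ13S : κ13 ≤ κS) (hA₀S : 0 ≤ A₀S) (hAW : 0 ≤ AW) (hAQ : 0 ≤ AQ) (hAD : 0 ≤ AD) (hADB12 : 2 * AD ≤ B12₃) (hAQ1 : 0 ≤ AQ1) (hCR : 0 ≤ CR)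
    (hAI : ∀ ε, 0 < ε → 0 ≤ AI ε) (hAV : ∀ ε, 0 < ε → 0 ≤ AV ε) (hρP12 : ρ12 + 2 * σ12 ≤ δP) (hδP₀ : δP ≤ δ12₀) (hδP₃ : δP ≤ δ12₃)
    (he1 : ∀ x : MemberY θ.d₆ θ.ℓ₆ θ.hd' θ.hL' θ.b₀ θ.b₁ Mstar, M12 ≤ (geo9Y x).M → ∀ α₀ : ℝ, 0 < α₀ → (geo9Y x).M * α₀ ≤ a12 → ∀ U : (bg9YR (Matrix (Fin N) (Fin N) ℂ) (specialUnitaryUnits (Fin N)) R₁ R₂ x).Cfg, (bg9YR (Matrix (Fin N) (Fin N) ℂ) (specialUnitaryUnits (Fin N)) R₁ R₂ x).Reg335 c α₀ U → (bg9YR (Matrix (Fin N) (Fin N) ℂ) (specialUnitaryUnits (Fin N)) R₁ R₂ x).Reg336 c α₀ U →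
  HasMajorantHom (g := toB6 (geo9Y x) 1 (H12 x)) (𝔬12 x).blk (𝔬12 x).blkY ((𝔬12 x).D U ∘ₗ (𝔬12 x).G0 U)
          (fun (a b : (geo9Y x).Site) => B12₀ * (geo9Y x).len a * Real.exp (-(δ12₀ * (geo9Y x).dist a b))))
    (hdomX : ∀ (x : MemberY θ.d₆ θ.ℓ₆ θ.hd' θ.hL' θ.b₀ θ.b₁ Mstar) (ε : ℝ), 0 < ε → ∃ ΛX : ℝ, 0 ≤ ΛX ∧
      ∀ (y : (geo9Y x).Site) (μ : XBK (TrIdx N) x.toKIdx → ℝ), (bHX12 x ε).IsLoc y μ → ∑ q : XBK (TrIdx N) x.toKIdx, |μ q| ≤ ΛX * (bHX12 x ε).loc y μ)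
    (hdomW : ∀ (x : MemberY θ.d₆ θ.ℓ₆ θ.hd' θ.hL' θ.b₀ θ.b₁ Mstar) (U : (bg9YR (Matrix (Fin N) (Fin N) ℂ) (specialUnitaryUnits (Fin N)) R₁ R₂ x).Cfg) (ε : ℝ), 0 < ε → ∃ ΛW : ℝ, 0 ≤ ΛW ∧
      ∀ (y : (geo9Y x).Site) (μ : W12 x → ℝ), (bHW13 x U ε).IsLoc y μ → ∑ w : W12 x, |μ w| ≤ ΛW * (bHW13 x U ε).loc y μ)
    (hst20 : ∀ j : J, M12 ≤ (geo9Y (f j)).M → ∀ α₀ : ℝ, 0 < α₀ → (geo9Y (f j)).M * α₀ ≤ a12 → ∀ U : (bg9YR (Matrix (Fin N) (Fin N) ℂ) (specialUnitaryUnits (Fin N)) R₁ R₂ (f j)).Cfg, (bg9YR (Matrix (Fin N) (Fin N) ℂ) (specialUnitaryUnits (Fin N)) R₁ R₂ (f j)).Reg335 c α₀ U → (bg9YR (Matrix (Fin N) (Fin N) ℂ) (specialUnitaryUnits (Fin N)) R₁ R₂ (f j)).Reg336 c α₀ U →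
        (StepS (𝔬12 (f j)) (weightNorm (bXH (f j) U) (rwt (geo9Y (f j)) (-1)) (rwt_nonneg (fun y => (geo9Y_len_pos (f j) y).le) (-1))) (θS * ((geo9Y (f j)).M * α₀)) δK12 U ∧
          (HasMaj (weightNorm (bXH (f j) U) (rwt (geo9Y (f j)) (-1)) (rwt_nonneg (fun y => (geo9Y_len_pos (f j) y).le) (-1))) (cNorm 1 (H12 (f j)) (𝔬12 (f j)).blkY (fun y => (geo9Y_len_pos (f j) y).le) 1) ((𝔬12 (f j)).D U ∘ₗ (𝔬12 (f j)).G0 U ∘ₗ (𝔬12 (f j)).Tpi U) (fun a b => θD12 * ((geo9Y (f j)).M * α₀) * Real.exp (-(δK12 * (geo9Y (f j)).dist a b))) ∧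
            HasMaj (weightNorm (bXH (f j) U) (rwt (geo9Y (f j)) (-1)) (rwt_nonneg (fun y => (geo9Y_len_pos (f j) y).le) (-1))) (cNorm 1 (H12 (f j)) (𝔬12 (f j)).blkY (fun y => (geo9Y_len_pos (f j) y).le) 1) ((𝔬12 (f j)).D U ∘ₗ (𝔬12 (f j)).G0 U ∘ₗ ((𝔬12 (f j)).Tpi U + (𝔬12 (f j)).T2 U)) (fun a b => θD12 * ((geo9Y (f j)).M * α₀) * Real.exp (-(δK12 * (geo9Y (f j)).dist a b)))) ∧
          (∀ β : ℝ, 0 ≤ β → β < 1 →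
            HasMaj (weightNorm (bXH (f j) U) (rwt (geo9Y (f j)) (-1)) (rwt_nonneg (fun y => (geo9Y_len_pos (f j) y).le) (-1))) (cNormR 1 (H12 (f j)) (𝔭A (f j)).blkPY (fun y => (geo9Y_len_pos (f j) y).le) (β - 1)) (((𝔭A (f j)).ΦY U β ∘ₗ (𝔬12 (f j)).D U ∘ₗ (𝔬12 (f j)).G0 U) ∘ₗ (𝔬12 (f j)).Tpi U) (fun a b => θH12 β * ((geo9Y (f j)).M * α₀) * Real.exp (-(δK12 * (geo9Y (f j)).dist a b))) ∧
            HasMaj (weightNorm (bXH (f j) U) (rwt (geo9Y (f j)) (-1)) (rwt_nonneg (fun y => (geo9Y_len_pos (f j) y).le) (-1))) (cNormR 1 (H12 (f j)) (𝔭A (f j)).blkPY (fun y => (geo9Y_len_pos (f j) y).le) (β - 1)) (((𝔭A (f j)).ΦY U β ∘ₗ (𝔬12 (f j)).D U ∘ₗ (𝔬12 (f j)).G0 U) ∘ₗ ((𝔬12 (f j)).Tpi U + (𝔬12 (f j)).T2 U)) (fun a b => θH12 β * ((geo9Y (f j)).M * α₀) * Real.exp (-(δK12 * (geo9Y (f j)).dist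 a b)))) ∧
          HasMaj (cNorm 1 (H12 (f j)) (𝔬12 (f j)).blk (fun y => (geo9Y_len_pos (f j) y).le) 0) (weightNorm (bXH (f j) U) (rwt (geo9Y (f j)) (-1)) (rwt_nonneg (fun y => (geo9Y_len_pos (f j) y).le) (-1))) ((𝔬12 (f j)).G0 U) (fun a b => A₀S * Real.exp (-(δP * (geo9Y (f j)).dist a b))) ∧
          HasMaj (weightNorm (BlockNorm.ofBlocks (toB6 (geo9Y (f j)) 1 (H12 (f j))) (𝔬12 (f j)).blkZ) (fun y => ((((θ.ℓ₆ + 1 : ℕ) : ℝ) ^ (θ.d₆ + 1)) ^ lvl (f j).hN (f j).D (f j).hk y)⁻¹) (fun y => (plateau_pos (f j).toKIdx y).le)) (weightNorm (bXH (f j) U) (rwt (geo9Y (f j)) (-1)) (rwt_nonneg (fun y => (geo9Y_len_pos (f j) y).le) (-1))) ((𝔬12 (f j)).G0 U ∘ₗ (𝔬12 (f j)).Qstar U) (fun a b => AQ * Real.exp (-(δP * (geo9Y (f j)).dist a b))) ∧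
          HasMaj (weightNorm (bXH (f j) U) (rwt (geo9Y (f j)) (-1)) (rwt_nonneg (fun y => (geo9Y_len_pos (f j) y).le) (-1))) (cNormR 1 (H12 (f j)) (𝔬12 (f j)).blk (fun y => (geo9Y_len_pos (f j) y).le) (-2)) LinearMap.id (fun a b => CR * Real.exp (-(δP * (geo9Y (f j)).dist a b))) ∧
          (weightNorm (bXH (f j) U) (rwt (geo9Y (f j)) (-1)) (rwt_nonneg (fun y => (geo9Y_len_pos (f j) y).le) (-1))).κ ≤ κS ∧
          (∃ Λ : ℝ, 0 ≤ Λ ∧ ∀ (y : (geo9Y (f j)).Site) (F : XBK (TrIdx N) (f j).toKIdx → ℝ), (weightNorm (bXH (f j) U) (rwt (geo9Y (f j)) (-1)) (rwt_nonneg (fun y => (geo9Y_len_pos (f j) y).le) (-1))).loc y F ≤ Λ * ∑ q : XBK (TrIdx N) (f j).toKIdx, |F q|)))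
    (hst10 : ∀ j : J, M12 ≤ (geo9Y (f j)).M → ∀ α₀ : ℝ, 0 < α₀ → (geo9Y (f j)).M * α₀ ≤ a12 → ∀ U : (bg9YR (Matrix (Fin N) (Fin N) ℂ) (specialUnitaryUnits (Fin N)) R₁ R₂ (f j)).Cfg, (bg9YR (Matrix (Fin N) (Fin N) ℂ) (specialUnitaryUnits (Fin N)) R₁ R₂ (f j)).Reg335 c α₀ U → (bg9YR (Matrix (Fin N) (Fin N) ℂ) (specialUnitaryUnits (Fin N)) R₁ R₂ (f j)).Reg336 c α₀ U →
        (StepS (𝔬12 (f j)) (bXH (f j) U) (θS * ((geo9Y (f j)).M * α₀)) δK12 U ∧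
          (∀ ν : Fin (θ.d₆ + 1),
            HasMaj (bXH (f j) U) (cNormR 1 (H12 (f j)) (𝔬12 (f j)).blk (fun y => (geo9Y_len_pos (f j) y).le) 0) (Dd (f j) U ν ∘ₗ (𝔬12 (f j)).G0 U ∘ₗ (𝔬12 (f j)).Tpi U) (fun a b => θD12 * ((geo9Y (f j)).M * α₀) * Real.exp (-(δK12 * (geo9Y (f j)).dist a b))) ∧
            HasMaj (bXH (f j) U) (cNormR 1 (H12 (f j)) (𝔬12 (f j)).blk (fun y => (geo9Y_len_pos (f j) y).le) 0) (Dd (f j) U ν ∘ₗ (𝔬12 (f j)).G0 U ∘ₗ ((𝔬12 (f j)).Tpi U + (𝔬12 (f j)).T2 U)) (fun a b => θD12 * ((geo9Y (f j)).M * α₀) * Real.exp (-(δK12 * (geo9Y (f j)).dist a b)))) ∧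
          (∀ β : ℝ, 0 ≤ β → β < 1 →
            HasMaj (bXH (f j) U) (cNormR 1 (H12 (f j)) (𝔭A (f j)).blkPX (fun y => (geo9Y_len_pos (f j) y).le) (β - 1)) (((𝔭A (f j)).ΦX U β ∘ₗ (𝔬12 (f j)).G0 U) ∘ₗ (𝔬12 (f j)).Tpi U) (fun a b => θH12 β * ((geo9Y (f j)).M * α₀) * Real.exp (-(δK12 * (geo9Y (f j)).dist a b))) ∧
            HasMaj (bXH (f j) U) (cNormR 1 (H12 (f j)) (𝔭A (f j)).blkPX (fun y => (geo9Y_len_pos (f j) y).le) (β - 1)) (((𝔭A (f j)).ΦX U β ∘ₗ (𝔬12 (f j)).G0 U) ∘ₗ ((𝔬12 (f j)).Tpi U + (𝔬12 (f j)).T2 U)) (fun a b => θH12 β * ((geo9Y (f j)).M * α₀) * Real.exp (-(δK12 * (geo9Y (f j)).dist a b)))) ∧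
          (∀ (ν : Fin (θ.d₆ + 1)) (β : ℝ), 0 ≤ β → β < 1 →
            HasMaj (bXH (f j) U) (cNormR 1 (H12 (f j)) (𝔭A (f j)).blkPX (fun y => (geo9Y_len_pos (f j) y).le) β) (((𝔭A (f j)).ΦX U β ∘ₗ Dd (f j) U ν ∘ₗ (𝔬12 (f j)).G0 U) ∘ₗ (𝔬12 (f j)).Tpi U) (fun a b => θH12 β * ((geo9Y (f j)).M * α₀) * Real.exp (-(δK12 * (geo9Y (f j)).dist a b))) ∧
            HasMaj (bXH (f j) U) (cNormR 1 (H12 (f j)) (𝔭A (f j)).blkPX (fun y => (geo9Y_len_pos (f j) y).le) β) (((𝔭A (f j)).ΦX U β ∘ₗ Dd (f j) U ν ∘ₗ (𝔬12 (f j)).G0 U) ∘ₗ ((𝔬12 (f j)).Tpi U + (𝔬12 (f j)).T2 U)) (fun a b => θH12 β * ((geo9Y (f j)).M * α₀) * Real.exp (-(δK12 * (geo9Y (f j)).dist a b)))) ∧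
          HasMaj (cNormR 1 (H12 (f j)) (𝔬12 (f j)).blkY (fun y => (geo9Y_len_pos (f j) y).le) 0) (bXH (f j) U) ((𝔬12 (f j)).G0 U ∘ₗ (𝔬12 (f j)).Dstar U) (fun a b => AD * Real.exp (-(δP * (geo9Y (f j)).dist a b))) ∧
          (∀ (μ : Fin (θ.d₆ + 1)) (ε : ℝ), 0 < ε → HasMaj (bHX12 (f j) ε) (bXH (f j) U) ((𝔬12 (f j)).G0 U ∘ₗ Dds (f j) U μ) (fun a b => AI ε * Real.exp (-(δP * (geo9Y (f j)).dist a b)))) ∧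
          HasMaj (bXH (f j) U) (cNormR 1 (H12 (f j)) (𝔬12 (f j)).blk (fun y => (geo9Y_len_pos (f j) y).le) (-1)) LinearMap.id (fun a b => CR * Real.exp (-(δP * (geo9Y (f j)).dist a b))) ∧
          (bXH (f j) U).κ ≤ κS ∧
          (∃ Λ : ℝ, 0 ≤ Λ ∧ ∀ (y : (geo9Y (f j)).Site) (F : XBK (TrIdx N) (f j).toKIdx → ℝ), (bXH (f j) U).loc y F ≤ Λ * ∑ q : XBK (TrIdx N) (f j).toKIdx, |F q|)))
    (hst21 : ∀ j : J, M12 ≤ (geo9Y (f j)).M → ∀ α₀ : ℝ, 0 < α₀ → (geo9Y (f j)).M * α₀ ≤ a12 → ∀ U : (bg9YR (Matrix (Fin N) (Fin N) ℂ) (specialUnitaryUnits (Fin N)) R₁ R₂ (f j)).Cfg, (bg9YR (Matrix (Fin N) (Fin N) ℂ) (specialUnitaryUnits (Fin N)) R₁ R₂ (f j)).Reg335 c α₀ U → (bg9YR (Matrix (Fin N) (Fin N) ℂ) (specialUnitaryUnits (Fin N)) R₁ R₂ (f j)).Reg336 c α₀ U →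
        (StepS (𝔬12 (f j)) (weightNorm (bXH (f j) U) (rwt (geo9Y (f j)) (-1)) (rwt_nonneg (fun y => (geo9Y_len_pos (f j) y).le) (-1))) (θS * ((geo9Y (f j)).M * α₀)) δK12 U ∧
          HasMaj (weightNorm (bXH (f j) U) (rwt (geo9Y (f j)) (-1)) (rwt_nonneg (fun y => (geo9Y_len_pos (f j) y).le) (-1))) (cNorm 1 (H12 (f j)) (𝔬12 (f j)).blkY (fun y => (geo9Y_len_pos (f j) y).le) 1) ((𝔬12 (f j)).D U ∘ₗ (𝔬12 (f j)).G0 U ∘ₗ ((𝔬12 (f j)).Tpi U + (𝔬12 (f j)).T2 U)) (fun a b => θD12 * ((geo9Y (f j)).M * α₀) * Real.exp (-(δK12 * (geo9Y (f j)).dist a b))) ∧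
          (∀ ν : Fin (θ.d₆ + 1), HasMaj (weightNorm (bXH (f j) U) (rwt (geo9Y (f j)) (-1)) (rwt_nonneg (fun y => (geo9Y_len_pos (f j) y).le) (-1))) (cNorm 1 (H12 (f j)) (𝔬12 (f j)).blk (fun y => (geo9Y_len_pos (f j) y).le) 1) (Dd (f j) U ν ∘ₗ (𝔬12 (f j)).G0 U ∘ₗ ((𝔬12 (f j)).Tpi U + (𝔬12 (f j)).T2 U)) (fun a b => θD12 * ((geo9Y (f j)).M * α₀) * Real.exp (-(δK12 * (geo9Y (f j)).dist a b)))) ∧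
          (∀ β : ℝ, 0 ≤ β → β < 1 → HasMaj (weightNorm (bXH (f j) U) (rwt (geo9Y (f j)) (-1)) (rwt_nonneg (fun y => (geo9Y_len_pos (f j) y).le) (-1))) (cNormR 1 (H12 (f j)) (𝔭A (f j)).blkPY (fun y => (geo9Y_len_pos (f j) y).le) (β - 1)) (((𝔭A (f j)).ΦY U β ∘ₗ (𝔬12 (f j)).D U ∘ₗ (𝔬12 (f j)).G0 U) ∘ₗ ((𝔬12 (f j)).Tpi U + (𝔬12 (f j)).T2 U)) (fun a b => θH12 β * ((geo9Y (f j)).M * α₀) * Real.exp (-(δK12 * (geo9Y (f j)).dist a b)))) ∧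
          (∀ (ν : Fin (θ.d₆ + 1)) (β : ℝ), 0 ≤ β → β < 1 → HasMaj (weightNorm (bXH (f j) U) (rwt (geo9Y (f j)) (-1)) (rwt_nonneg (fun y => (geo9Y_len_pos (f j) y).le) (-1))) (cNormR 1 (H12 (f j)) (𝔭A (f j)).blkPX (fun y => (geo9Y_len_pos (f j) y).le) (β - 1)) (((𝔭A (f j)).ΦX U β ∘ₗ Dd (f j) U ν ∘ₗ (𝔬12 (f j)).G0 U) ∘ₗ ((𝔬12 (f j)).Tpi U + (𝔬12 (f j)).T2 U)) (fun a b => θH12 β * ((geo9Y (f j)).M * α₀) * Real.exp (-(δK12 * (geo9Y (f j)).dist a b)))) ∧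
          HasMaj (cNorm 1 (H12 (f j)) (𝔬12 (f j)).blk (fun y => (geo9Y_len_pos (f j) y).le) 0) (weightNorm (bXH (f j) U) (rwt (geo9Y (f j)) (-1)) (rwt_nonneg (fun y => (geo9Y_len_pos (f j) y).le) (-1))) ((𝔬12 (f j)).G0 U) (fun a b => A₀S * Real.exp (-(δP * (geo9Y (f j)).dist a b))) ∧
          HasMaj (cNorm 1 (H12 (f j)) (𝔬12 (f j)).blkW (fun y => (geo9Y_len_pos (f j) y).le) 1) (weightNorm (bXH (f j) U) (rwt (geo9Y (f j)) (-1)) (rwt_nonneg (fun y => (geo9Y_len_pos (f j) y).le) (-1))) ((𝔬12 (f j)).G0 U ∘ₗ (𝔬12 (f j)).Dv U) (fun a b => AW * Real.exp (-(δP * (geo9Y (f j)).dist a b))) ∧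
          HasMaj (weightNorm (BlockNorm.ofBlocks (toB6 (geo9Y (f j)) 1 (H12 (f j))) (𝔬12 (f j)).blkZ) (fun y => ((((θ.ℓ₆ + 1 : ℕ) : ℝ) ^ (θ.d₆ + 1)) ^ lvl (f j).hN (f j).D (f j).hk y)⁻¹) (fun y => (plateau_pos (f j).toKIdx y).le)) (weightNorm (bXH (f j) U) (rwt (geo9Y (f j)) (-1)) (rwt_nonneg (fun y => (geo9Y_len_pos (f j) y).le) (-1))) ((𝔬12 (f j)).G0 U ∘ₗ (𝔬12 (f j)).Qstar U) (fun a b => AQ * Real.exp (-(δP * (geo9Y (f j)).dist a b))) ∧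
          HasMaj (weightNorm (bXH (f j) U) (rwt (geo9Y (f j)) (-1)) (rwt_nonneg (fun y => (geo9Y_len_pos (f j) y).le) (-1))) (cNormR 1 (H12 (f j)) (𝔬12 (f j)).blk (fun y => (geo9Y_len_pos (f j) y).le) (-2)) LinearMap.id (fun a b => CR * Real.exp (-(δP * (geo9Y (f j)).dist a b))) ∧
          (∃ Λ : ℝ, 0 ≤ Λ ∧ ∀ (y : (geo9Y (f j)).Site) (F : XBK (TrIdx N) (f j).toKIdx → ℝ), (weightNorm (bXH (f j) U) (rwt (geo9Y (f j)) (-1)) (rwt_nonneg (fun y => (geo9Y_len_pos (f j) y).le) (-1))).loc y F ≤ Λ * ∑ q : XBK (TrIdx N) (f j).toKIdx, |F q|)))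
    (hst11 : ∀ j : J, M12 ≤ (geo9Y (f j)).M → ∀ α₀ : ℝ, 0 < α₀ → (geo9Y (f j)).M * α₀ ≤ a12 → ∀ U : (bg9YR (Matrix (Fin N) (Fin N) ℂ) (specialUnitaryUnits (Fin N)) R₁ R₂ (f j)).Cfg, (bg9YR (Matrix (Fin N) (Fin N) ℂ) (specialUnitaryUnits (Fin N)) R₁ R₂ (f j)).Reg335 c α₀ U → (bg9YR (Matrix (Fin N) (Fin N) ℂ) (specialUnitaryUnits (Fin N)) R₁ R₂ (f j)).Reg336 c α₀ U →
        (StepS (𝔬12 (f j)) (bXH (f j) U) (θS * ((geo9Y (f j)).M * α₀)) δK12 U ∧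
          (∀ ν : Fin (θ.d₆ + 1), HasMaj (bXH (f j) U) (cNormR 1 (H12 (f j)) (𝔬12 (f j)).blk (fun y => (geo9Y_len_pos (f j) y).le) 0) (Dd (f j) U ν ∘ₗ (𝔬12 (f j)).G0 U ∘ₗ ((𝔬12 (f j)).Tpi U + (𝔬12 (f j)).T2 U)) (fun a b => θD12 * ((geo9Y (f j)).M * α₀) * Real.exp (-(δK12 * (geo9Y (f j)).dist a b)))) ∧
          (∀ β : ℝ, 0 ≤ β → β < 1 → HasMaj (bXH (f j) U) (cNormR 1 (H12 (f j)) (𝔭A (f j)).blkPX (fun y => (geo9Y_len_pos (f j) y).le) (β - 1)) (((𝔭A (f j)).ΦX U β ∘ₗ (𝔬12 (f j)).G0 U) ∘ₗ ((𝔬12 (f j)).Tpi U + (𝔬12 (f j)).T2 U)) (fun a b => θH12 β * ((geo9Y (f j)).M * α₀) * Real.exp (-(δK12 * (geo9Y (f j)).dist a b)))) ∧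
          (∀ (ν : Fin (θ.d₆ + 1)) (β : ℝ), 0 ≤ β → β < 1 → HasMaj (bXH (f j) U) (cNormR 1 (H12 (f j)) (𝔭A (f j)).blkPX (fun y => (geo9Y_len_pos (f j) y).le) β) (((𝔭A (f j)).ΦX U β ∘ₗ Dd (f j) U ν ∘ₗ (𝔬12 (f j)).G0 U) ∘ₗ ((𝔬12 (f j)).Tpi U + (𝔬12 (f j)).T2 U)) (fun a b => θH12 β * ((geo9Y (f j)).M * α₀) * Real.exp (-(δK12 * (geo9Y (f j)).dist a b)))) ∧
          HasMaj (cNormR 1 (H12 (f j)) (𝔬12 (f j)).blkY (fun y => (geo9Y_len_pos (f j) y).le) 0) (bXH (f j) U) ((𝔬12 (f j)).G0 U ∘ₗ (𝔬12 (f j)).Dstar U) (fun a b => AD * Real.exp (-(δP * (geo9Y (f j)).dist a b))) ∧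
          (∀ (μ : Fin (θ.d₆ + 1)) (ε : ℝ), 0 < ε → HasMaj (bHX12 (f j) ε) (bXH (f j) U) ((𝔬12 (f j)).G0 U ∘ₗ Dds (f j) U μ) (fun a b => AI ε * Real.exp (-(δP * (geo9Y (f j)).dist a b)))) ∧
          (∀ ε : ℝ, 0 < ε → HasMaj (bHW13 (f j) U ε) (bXH (f j) U) ((𝔬12 (f j)).G0 U ∘ₗ (𝔬12 (f j)).Dv U) (fun a b => AV ε * Real.exp (-(δP * (geo9Y (f j)).dist a b)))) ∧
          HasMaj (weightNorm (BlockNorm.ofBlocks (toB6 (geo9Y (f j)) 1 (H12 (f j))) (𝔬12 (f j)).blkZ) (fun y => (geo9Y (f j)).len y * ((((θ.ℓ₆ + 1 : ℕ) : ℝ) ^ (θ.d₆ + 1)) ^ lvl (f j).hN (f j).D (f j).hk y)⁻¹) (fun y => (mul_pos (geo9Y_len_pos (f j) y) (plateau_pos (f j).toKIdx y)).le)) (bXH (f j) U) ((𝔬12 (f j)).G0 U ∘ₗ (𝔬12 (f j)).Qstar U) (fun a b => AQ1 * Real.exp (-(δP * (geo9Y (f j)).dist a b))) ∧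
          HasMaj (bXH (f j) U) (cNormR 1 (H12 (f j)) (𝔬12 (f j)).blk (fun y => (geo9Y_len_pos (f j) y).le) (-1)) LinearMap.id (fun a b => CR * Real.exp (-(δP * (geo9Y (f j)).dist a b))) ∧
          (∃ Λ : ℝ, 0 ≤ Λ ∧ ∀ (y : (geo9Y (f j)).Site) (F : XBK (TrIdx N) (f j).toKIdx → ℝ), (bXH (f j) U).loc y F ≤ Λ * ∑ q : XBK (TrIdx N) (f j).toKIdx, |F q|)))
    : B9.Thm312Printed (θ.d₆ + 1) c (fun j : J => geo9Y (f j)) (fun j : J => bg9YR (Matrix (Fin N) (Fin N) ℂ) (specialUnitaryUnits (Fin N)) R₁ R₂ (f j)) (fun j => kernelFamilyR R₁ R₂ (𝔒 (f j)).GD) (fun j => kernelFamilyR R₁ R₂ (𝔒 (f j)).G₁) (fun j => hKernelR R₁ R₂ (𝔒 (f j)).H) (fun j => hKernelR R₁ R₂ (𝔒 (f j)).H₁)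
        (fun j K => (𝔒 (f j)).HasRWExp (kernelFamilyRY K)) (fun j K => (𝔒 (f j)).HasRWExpH (hKernelRY K)) (fun j K => (𝔒 (f j)).PosDefK (kernelFamilyRY K)) ∧
      B9.Thm313Printed c (fun j : J => geo9Y (f j)) (fun j : J => bg9YR (Matrix (Fin N) (Fin N) ℂ) (specialUnitaryUnits (Fin N)) R₁ R₂ (f j)) (fun j => kernelFamilyR R₁ R₂ (𝔒 (f j)).GG) (fun j K => (𝔒 (f j)).HasRWExp (kernelFamilyRY K)) (fun j K => (𝔒 (f j)).PosDefK (kernelFamilyRY K)) := by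
  have hL1 : (1 : ℝ) ≤ ((θ.ℓ₆ + 1 : ℕ) : ℝ) := by exact_mod_cast Nat.succ_le_succ (Nat.zero_le _)
  have hsat : ∀ (x : MemberY θ.d₆ θ.ℓ₆ θ.hd' θ.hL' θ.b₀ θ.b₁ Mstar) (n : Fin 4) (B' δ' : ℝ),
      (∀ a a' b, RelB x.toKIdx a a' → maj342 (geo9Y x) n B' δ' a b = maj342 (geo9Y x) n B' δ' a' b) ∧
      (∀ a b b', RelB x.toKIdx b b' → maj342 (geo9Y x) n B' δ' a b = maj342 (geo9Y x) n B' δ' a b') :=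
    fun x n B' δ' => ⟨fun a a' b h => maj342_relB_left x.toKIdx n B' δ' a a' b h, fun a b b' h => maj342_relB_right x.toKIdx n B' δ' a b b' h⟩
  have hmult : ∀ (x : MemberY θ.d₆ θ.ℓ₆ θ.hd' θ.hL' θ.b₀ θ.b₁ Mstar) (y' : (geo9Y x).Site),
      (Finset.univ.filter (fun y'' : (geo9Y x).Site => RelB x.toKIdx y'' y')).card ≤ 2 * (θ.d₆ + 1) := fun x y' => by
    refine le_trans (Finset.card_le_card fun c hc => ?_) (card_sameCarrier_le_kIdx x.toKIdx y')
    exact Finset.mem_filter.2 ⟨@Finset.mem_univ _ (_) c, (Finset.mem_filter.1 hc).2⟩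
  have hRdist : ∀ (x : MemberY θ.d₆ θ.ℓ₆ θ.hd' θ.hL' θ.b₀ θ.b₁ Mstar) (a a' b : (geo9Y x).Site), RelB x.toKIdx a a' → (geo9Y x).dist a b = (geo9Y x).dist a' b :=
    fun x a a' b h => dist_eq_of_relB x.toKIdx h (relB_refl x.toKIdx b)
  have hRlen : ∀ (x : MemberY θ.d₆ θ.ℓ₆ θ.hd' θ.hL' θ.b₀ θ.b₁ Mstar) (a a' : (geo9Y x).Site), RelB x.toKIdx a a' → (geo9Y x).len a = (geo9Y x).len a' :=
    fun x a a' h => len_eq_of_relB x.toKIdx h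
  -- the (3.42)∕(3.47)∕(3.133) co-readings of G_D, G₁, 𝔊, H, H₁ at the pins (`N06CoReadingsOfPins`, `B9CoReadingCoordsH`)
  letI hF : ∀ x : MemberY θ.d₆ θ.ℓ₆ θ.hd' θ.hL' θ.b₀ θ.b₁ Mstar, Fintype (B9GeoNormsKLevelV1.geo9K x.toKIdx).Site := fun x => (inferInstance : Fintype (geo9Y x).Site)
  have hGD := fun (x : MemberY θ.d₆ θ.ℓ₆ θ.hd' θ.hL' θ.b₀ θ.b₁ Mstar) (U : (bg9YR (Matrix (Fin N) (Fin N) ℂ) (specialUnitaryUnits (Fin N)) R₁ R₂ x).Cfg) => bond_coReadings3_of_pins x.toKIdx (trBasis N) (bg9YR (Matrix (Fin N) (Fin N) ℂ) (specialUnitaryUnits (Fin N)) R₁ R₂ x) (fun U => U) (𝔏 x).GD (𝔏 x).parB U (hβI x) (hlev x) (hblk12 x) (hblkY12 x) (hGco12 x U) (hDco12 x U) (hDsco12 x U)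
  have hG1 := fun (x : MemberY θ.d₆ θ.ℓ₆ θ.hd' θ.hL' θ.b₀ θ.b₁ Mstar) (U : (bg9YR (Matrix (Fin N) (Fin N) ℂ) (specialUnitaryUnits (Fin N)) R₁ R₂ x).Cfg) => bond_coReadings3_of_pins x.toKIdx (trBasis N) (bg9YR (Matrix (Fin N) (Fin N) ℂ) (specialUnitaryUnits (Fin N)) R₁ R₂ x) (fun U => U) (𝔏 x).G₁ (𝔏 x).parB U (hβI x) (hlev x) (hblk12 x) (hblkY12 x) (hG1co12 x U) (hDco12 x U) (hDsco12 x U)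
  have hGG := fun (x : MemberY θ.d₆ θ.ℓ₆ θ.hd' θ.hL' θ.b₀ θ.b₁ Mstar) (U : (bg9YR (Matrix (Fin N) (Fin N) ℂ) (specialUnitaryUnits (Fin N)) R₁ R₂ x).Cfg) => bond_coReadings3_of_pins x.toKIdx (trBasis N) (bg9YR (Matrix (Fin N) (Fin N) ℂ) (specialUnitaryUnits (Fin N)) R₁ R₂ x) (fun U => U) (𝔏 x).GG (𝔏 x).parB U (hβI x) (hlev x) (hblk12 x) (hblkY12 x) (hGGco12 x U) (hDco12 x U) (hDsco12 x U)
  have hHH := fun (x : MemberY θ.d₆ θ.ℓ₆ θ.hd' θ.hL' θ.b₀ θ.b₁ Mstar) (U : (bg9YR (Matrix (Fin N) (Fin N) ℂ) (specialUnitaryUnits (Fin N)) R₁ R₂ x).Cfg) => coRealizesHRel_of_pins x.toKIdx (trBasis N) (bg9YR (Matrix (Fin N) (Fin N) ℂ) (specialUnitaryUnits (Fin N)) R₁ R₂ x) (fun U => U) (𝔏 x).H (𝔏 x).parB U (hβI x) (hblk12 x) (hblkY12 x) (hblkZ12 x) (hHm12 x U) (hDco12 x U)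
  have hHH1 := fun (x : MemberY θ.d₆ θ.ℓ₆ θ.hd' θ.hL' θ.b₀ θ.b₁ Mstar) (U : (bg9YR (Matrix (Fin N) (Fin N) ℂ) (specialUnitaryUnits (Fin N)) R₁ R₂ x).Cfg) => coRealizesHRel_of_pins x.toKIdx (trBasis N) (bg9YR (Matrix (Fin N) (Fin N) ℂ) (specialUnitaryUnits (Fin N)) R₁ R₂ x) (fun U => U) (𝔏 x).H₁ (𝔏 x).parB U (hβI x) (hblk12 x) (hblkY12 x) (hblkZ12 x) (hH1m12 x U) (hDco12 x U)
  have hcoHR12 := fun (x : MemberY θ.d₆ θ.ℓ₆ θ.hd' θ.hL' θ.b₀ θ.b₁ Mstar) (U : (bg9YR (Matrix (Fin N) (Fin N) ℂ) (specialUnitaryUnits (Fin N)) R₁ R₂ x).Cfg) => And.intro (hHH x U).1 (And.intro (hHH x U).2 (And.intro (hHH1 x U).1 (hHH1 x U).2))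
  have hcoR12 := fun (x : MemberY θ.d₆ θ.ℓ₆ θ.hd' θ.hL' θ.b₀ θ.b₁ Mstar) (U : (bg9YR (Matrix (Fin N) (Fin N) ℂ) (specialUnitaryUnits (Fin N)) R₁ R₂ x).Cfg) => And.intro (hGD x U).1 (And.intro (hGD x U).2.2.1 (And.intro (hG1 x U).1 (hG1 x U).2.2.1))
  have hco1R12 := fun (x : MemberY θ.d₆ θ.ℓ₆ θ.hd' θ.hL' θ.b₀ θ.b₁ Mstar) (U : (bg9YR (Matrix (Fin N) (Fin N) ℂ) (specialUnitaryUnits (Fin N)) R₁ R₂ x).Cfg) => And.intro (hGD x U).2.1 (hG1 x U).2.1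
  have hcoG12 := fun (x : MemberY θ.d₆ θ.ℓ₆ θ.hd' θ.hL' θ.b₀ θ.b₁ Mstar) (U : (bg9YR (Matrix (Fin N) (Fin N) ℂ) (specialUnitaryUnits (Fin N)) R₁ R₂ x).Cfg) => And.intro (hGD x U).2.2.2.1 (And.intro (hGD x U).2.2.2.2.1 (And.intro (hGD x U).2.2.2.2.2.1 (And.intro (hG1 x U).2.2.2.1 (And.intro (hG1 x U).2.2.2.2.1 (hG1 x U).2.2.2.2.2.1))))
  -- row 20's twelve (3.46) L² readings of G_D, G₁ are THEOREMS on the coordinate models (`bond_l2ReadsNbr3_of_pins` + n06-k `bond_l2ReadsNbr345_of_pins` at the pinned direction letters)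
  have hDL := fun (x : MemberY θ.d₆ θ.ℓ₆ θ.hd' θ.hL' θ.b₀ θ.b₁ Mstar) (U : (bg9YR (Matrix (Fin N) (Fin N) ℂ) (specialUnitaryUnits (Fin N)) R₁ R₂ x).Cfg) => bond_l2ReadsNbr3_of_pins x.toKIdx (trBasis N) (bg9YR (Matrix (Fin N) (Fin N) ℂ) (specialUnitaryUnits (Fin N)) R₁ R₂ x) (fun U => U) (𝔏 x).GD (𝔏 x).parB U (R := (1 : ℝ)) (H := H12 x) (hβI x) (hβ1 x) (hblk12 x) (hblkY12 x) (hGco12 x U) (hDco12 x U) (hDsco12 x U)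
  have hDL3 := fun (x : MemberY θ.d₆ θ.ℓ₆ θ.hd' θ.hL' θ.b₀ θ.b₁ Mstar) (U : (bg9YR (Matrix (Fin N) (Fin N) ℂ) (specialUnitaryUnits (Fin N)) R₁ R₂ x).Cfg) => bond_l2ReadsNbr345_of_pins x.toKIdx (trBasis N) (bg9YR (Matrix (Fin N) (Fin N) ℂ) (specialUnitaryUnits (Fin N)) R₁ R₂ x) (fun U => U) (𝔏 x).GD (𝔏 x).parB U (R := (1 : ℝ)) (H := H12 x) (hβI x) (hβ1 x) (hblk12 x) (hGco12 x U) (hDd x U) (hDds x U)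
  have h1L := fun (x : MemberY θ.d₆ θ.ℓ₆ θ.hd' θ.hL' θ.b₀ θ.b₁ Mstar) (U : (bg9YR (Matrix (Fin N) (Fin N) ℂ) (specialUnitaryUnits (Fin N)) R₁ R₂ x).Cfg) => bond_l2ReadsNbr3_of_pins x.toKIdx (trBasis N) (bg9YR (Matrix (Fin N) (Fin N) ℂ) (specialUnitaryUnits (Fin N)) R₁ R₂ x) (fun U => U) (𝔏 x).G₁ (𝔏 x).parB U (R := (1 : ℝ)) (H := H12 x) (hβI x) (hβ1 x) (hblk12 x) (hblkY12 x) (hG1co12 x U) (hDco12 x U) (hDsco12 x U)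
  have h1L3 := fun (x : MemberY θ.d₆ θ.ℓ₆ θ.hd' θ.hL' θ.b₀ θ.b₁ Mstar) (U : (bg9YR (Matrix (Fin N) (Fin N) ℂ) (specialUnitaryUnits (Fin N)) R₁ R₂ x).Cfg) => bond_l2ReadsNbr345_of_pins x.toKIdx (trBasis N) (bg9YR (Matrix (Fin N) (Fin N) ℂ) (specialUnitaryUnits (Fin N)) R₁ R₂ x) (fun U => U) (𝔏 x).G₁ (𝔏 x).parB U (R := (1 : ℝ)) (H := H12 x) (hβI x) (hβ1 x) (hblk12 x) (hG1co12 x U) (hDd x U) (hDds x U)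
  have hGL := fun (x : MemberY θ.d₆ θ.ℓ₆ θ.hd' θ.hL' θ.b₀ θ.b₁ Mstar) (U : (bg9YR (Matrix (Fin N) (Fin N) ℂ) (specialUnitaryUnits (Fin N)) R₁ R₂ x).Cfg) => bond_l2ReadsNbr3_of_pins x.toKIdx (trBasis N) (bg9YR (Matrix (Fin N) (Fin N) ℂ) (specialUnitaryUnits (Fin N)) R₁ R₂ x) (fun U => U) (𝔏 x).GG (𝔏 x).parB U (R := (1 : ℝ)) (H := H12 x) (hβI x) (hβ1 x) (hblk12 x) (hblkY12 x) (hGGco12 x U) (hDco12 x U) (hDsco12 x U)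
  have hGL3 := fun (x : MemberY θ.d₆ θ.ℓ₆ θ.hd' θ.hL' θ.b₀ θ.b₁ Mstar) (U : (bg9YR (Matrix (Fin N) (Fin N) ℂ) (specialUnitaryUnits (Fin N)) R₁ R₂ x).Cfg) => bond_l2ReadsNbr345_of_pins x.toKIdx (trBasis N) (bg9YR (Matrix (Fin N) (Fin N) ℂ) (specialUnitaryUnits (Fin N)) R₁ R₂ x) (fun U => U) (𝔏 x).GG (𝔏 x).parB U (R := (1 : ℝ)) (H := H12 x) (hβI x) (hβ1 x) (hblk12 x) (hGGco12 x U) (hDd x U) (hDds x U)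
  have hsym12 : ∀ x : MemberY θ.d₆ θ.ℓ₆ θ.hd' θ.hL' θ.b₀ θ.b₁ Mstar, M12 ≤ (geo9Y x).M → ∀ α₀ : ℝ, 0 < α₀ → (geo9Y x).M * α₀ ≤ a12 → ∀ U : (bg9YR (Matrix (Fin N) (Fin N) ℂ) (specialUnitaryUnits (Fin N)) R₁ R₂ x).Cfg, (bg9YR (Matrix (Fin N) (Fin N) ℂ) (specialUnitaryUnits (Fin N)) R₁ R₂ x).Reg335 c α₀ U → (bg9YR (Matrix (Fin N) (Fin N) ℂ) (specialUnitaryUnits (Fin N)) R₁ R₂ x).Reg336 c α₀ U → 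
        (IsTransposePair ((𝔬12 x).G U) ((𝔬12 x).G U) ∧ IsTransposePair ((𝔬12 x).G1 U) ((𝔬12 x).G1 U)) ∧
        (IsTransposePair ((𝔬12 x).D U ∘ₗ (𝔬12 x).G U) ((𝔬12 x).G U ∘ₗ (𝔬12 x).Dstar U) ∧ IsTransposePair ((𝔬12 x).D U ∘ₗ (𝔬12 x).G1 U) ((𝔬12 x).G1 U ∘ₗ (𝔬12 x).Dstar U)) :=
    fun x hM α₀ hα ha U hU _ => by
    obtain ⟨hD, h1, -⟩ := hsymD x hM α₀ hα ha U hU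
    rw [hGco12 x U, hG1co12 x U, hDco12 x U, hDsco12 x U]
    exact ⟨⟨isTransposePair_GcoK_trBasis x.toKIdx (bg9YR (Matrix (Fin N) (Fin N) ℂ) (specialUnitaryUnits (Fin N)) R₁ R₂ x) (fun U => U) (𝔏 x).GD U hD, isTransposePair_GcoK_trBasis x.toKIdx (bg9YR (Matrix (Fin N) (Fin N) ℂ) (specialUnitaryUnits (Fin N)) R₁ R₂ x) (fun U => U) (𝔏 x).G₁ U h1⟩,
      ⟨isTransposePair_DcoK_GcoK_trBasis x.toKIdx (bg9YR (Matrix (Fin N) (Fin N) ℂ) (specialUnitaryUnits (Fin N)) R₁ R₂ x) (fun U => U) (𝔏 x).GD U hD (fun μ z => specialUnitaryUnits_le_unitaryUnits (mem_of_reg335R hGR x hU μ z)),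
        isTransposePair_DcoK_GcoK_trBasis x.toKIdx (bg9YR (Matrix (Fin N) (Fin N) ℂ) (specialUnitaryUnits (Fin N)) R₁ R₂ x) (fun U => U) (𝔏 x).G₁ U h1 (fun μ z => specialUnitaryUnits_le_unitaryUnits (mem_of_reg335R hGR x hU μ z))⟩⟩
  have hsym13 : ∀ x : MemberY θ.d₆ θ.ℓ₆ θ.hd' θ.hL' θ.b₀ θ.b₁ Mstar, M12 ≤ (geo9Y x).M → ∀ α₀ : ℝ, 0 < α₀ → (geo9Y x).M * α₀ ≤ a12 → ∀ U : (bg9YR (Matrix (Fin N) (Fin N) ℂ) (specialUnitaryUnits (Fin N)) R₁ R₂ x).Cfg, (bg9YR (Matrix (Fin N) (Fin N) ℂ) (specialUnitaryUnits (Fin N)) R₁ R₂ x).Reg335 c α₀ U → (bg9YR (Matrix (Fin N) (Fin N) ℂ) (specialUnitaryUnits (Fin N)) R₁ R₂ x).Reg336 c α₀ U → IsTransposePair ((𝔬12 x).GG U) ((𝔬12 x).GG U) ∧ IsTransposePair ((𝔬12 x).D U ∘ₗ (𝔬12 x).GG U) ((𝔬12 x).GG U ∘ₗ (𝔬12 x).Dstar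 U) :=
    fun x hM α₀ hα ha U hU _ => by
    obtain ⟨-, -, hG⟩ := hsymD x hM α₀ hα ha U hU
    rw [hGGco12 x U, hDco12 x U, hDsco12 x U]
    exact ⟨isTransposePair_GcoK_trBasis x.toKIdx (bg9YR (Matrix (Fin N) (Fin N) ℂ) (specialUnitaryUnits (Fin N)) R₁ R₂ x) (fun U => U) (𝔏 x).GG U hG,
      isTransposePair_DcoK_GcoK_trBasis x.toKIdx (bg9YR (Matrix (Fin N) (Fin N) ℂ) (specialUnitaryUnits (Fin N)) R₁ R₂ x) (fun U => U) (𝔏 x).GG U hG (fun μ z => specialUnitaryUnits_le_unitaryUnits (mem_of_reg335R hGR x hU μ z))⟩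
  have hcoR13 := fun (x : MemberY θ.d₆ θ.ℓ₆ θ.hd' θ.hL' θ.b₀ θ.b₁ Mstar) (U : (bg9YR (Matrix (Fin N) (Fin N) ℂ) (specialUnitaryUnits (Fin N)) R₁ R₂ x).Cfg) => And.intro (hGG x U).1 (hGG x U).2.2.1
  have hco1R13 := fun (x : MemberY θ.d₆ θ.ℓ₆ θ.hd' θ.hL' θ.b₀ θ.b₁ Mstar) (U : (bg9YR (Matrix (Fin N) (Fin N) ℂ) (specialUnitaryUnits (Fin N)) R₁ R₂ x).Cfg) => (hGG x U).2.1
  have hcoG13 := fun (x : MemberY θ.d₆ θ.ℓ₆ θ.hd' θ.hL' θ.b₀ θ.b₁ Mstar) (U : (bg9YR (Matrix (Fin N) (Fin N) ℂ) (specialUnitaryUnits (Fin N)) R₁ R₂ x).Cfg) => And.intro (hGG x U).2.2.2.1 (And.intro (hGG x U).2.2.2.2.1 (hGG x U).2.2.2.2.2.1)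
  have hgeoOK : ∀ x : MemberY θ.d₆ θ.ℓ₆ θ.hd' θ.hL' θ.b₀ θ.b₁ Mstar, GeoOK (geo9Y x) := fun x => ⟨geo9Y_dist_triangle x, geo9Y_dist_comm x, geo9K_dist_nonneg x.toKIdx, geo9Y_len_pos x⟩
  -- face v1.5∕v1.6: the DERIVED Z-letters (v1.6: conjunct 5, C₁'s (3.132) class letter, also feeds the block-L² `c1` field of row 21 through `c1L2_of_pinsR`) (q2 q1; gQs2 dgQs; c2 c12 c1_1 from the certificate's own ROW 26) with produced threshold, regime, rate δC, constant
  have hδ30 : 0 < δ12₃ := by linarith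
  -- [CASCADE-K] the kernel slots of `𝔒` read through their `rfl`-pins, in the class-parametric typing (`kernelFamilyR ∘ kernelFamilyB … bg9Y … = kernelFamilyB … bg9YR …` etc., `rfl`)
  have e𝔒GD : ∀ x : MemberY θ.d₆ θ.ℓ₆ θ.hd' θ.hL' θ.b₀ θ.b₁ Mstar, kernelFamilyR R₁ R₂ (𝔒 x).GD = kernelFamilyB x.toKIdx (bg9YR (Matrix (Fin N) (Fin N) ℂ) (specialUnitaryUnits (Fin N)) R₁ R₂ x) (fun U => U) (𝔏 x).GD (𝔏 x).parB := fun x => by rw [h𝔒GD x]; rfl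
  have e𝔒G1 : ∀ x : MemberY θ.d₆ θ.ℓ₆ θ.hd' θ.hL' θ.b₀ θ.b₁ Mstar, kernelFamilyR R₁ R₂ (𝔒 x).G₁ = kernelFamilyB x.toKIdx (bg9YR (Matrix (Fin N) (Fin N) ℂ) (specialUnitaryUnits (Fin N)) R₁ R₂ x) (fun U => U) (𝔏 x).G₁ (𝔏 x).parB := fun x => by rw [h𝔒G₁ x]; rfl
  have e𝔒GG : ∀ x : MemberY θ.d₆ θ.ℓ₆ θ.hd' θ.hL' θ.b₀ θ.b₁ Mstar, kernelFamilyR R₁ R₂ (𝔒 x).GG = kernelFamilyB x.toKIdx (bg9YR (Matrix (Fin N) (Fin N) ℂ) (specialUnitaryUnits (Fin N)) R₁ R₂ x) (fun U => U) (𝔏 x).GG (𝔏 x).parB := fun x => by rw [h𝔒GG x]; rfl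
  have e𝔒H : ∀ x : MemberY θ.d₆ θ.ℓ₆ θ.hd' θ.hL' θ.b₀ θ.b₁ Mstar, hKernelR R₁ R₂ (𝔒 x).H = hKernelOfOp x.toKIdx (bg9YR (Matrix (Fin N) (Fin N) ℂ) (specialUnitaryUnits (Fin N)) R₁ R₂ x) (fun U => U) (𝔏 x).H (𝔏 x).parB := fun x => by rw [h𝔒H x]; rfl
  have e𝔒H1 : ∀ x : MemberY θ.d₆ θ.ℓ₆ θ.hd' θ.hL' θ.b₀ θ.b₁ Mstar, hKernelR R₁ R₂ (𝔒 x).H₁ = hKernelOfOp x.toKIdx (bg9YR (Matrix (Fin N) (Fin N) ℂ) (specialUnitaryUnits (Fin N)) R₁ R₂ x) (fun U => U) (𝔏 x).H₁ (𝔏 x).parB := fun x => by rw [h𝔒H₁ x]; rfl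
  have e𝔒Q : (fun x : MemberY θ.d₆ θ.ℓ₆ θ.hd' θ.hL' θ.b₀ θ.b₁ Mstar => siteKernelR R₁ R₂ (𝔒 x).QGQinv) = fun x => siteKernelOfOpNu x.toKIdx (bg9YR (Matrix (Fin N) (Fin N) ℂ) (specialUnitaryUnits (Fin N)) R₁ R₂ x) (fun U => U) (nuY (θ.d₆ + 1) x.toKIdx) (QGQinvQY x.toKIdx (𝔮 x.toKIdx) (𝔮s x.toKIdx) (parS x.toKIdx) (GpPhysY x.toKIdx (parS x.toKIdx))) := funext fun x => by rw [h𝔒QGQ x]; rfl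
  have e𝔒Q1 : (fun x : MemberY θ.d₆ θ.ℓ₆ θ.hd' θ.hL' θ.b₀ θ.b₁ Mstar => siteKernelR R₁ R₂ (𝔒 x).QG1Qinv) = fun x => siteKernelOfOpNu x.toKIdx (bg9YR (Matrix (Fin N) (Fin N) ℂ) (specialUnitaryUnits (Fin N)) R₁ R₂ x) (fun U => U) (nuY (θ.d₆ + 1) x.toKIdx) (QG1QinvQY x.toKIdx (𝔮 x.toKIdx) (𝔮s x.toKIdx) (parS x.toKIdx) (GpPhysY x.toKIdx (parS x.toKIdx)) (Δ2 x)) := funext fun x => by rw [h𝔒QG1Q x]; rfl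
  simp only [e𝔒GD, e𝔒G1, e𝔒GG, e𝔒H, e𝔒H1] at hH1N hIF hHCN
  have e𝔒Qx := fun x => congrFun e𝔒Q x
  have e𝔒Q1x := fun x => congrFun e𝔒Q1 x
  beta_reduce at e𝔒Qx e𝔒Q1x
  simp only [e𝔒Qx, e𝔒Q1x] at h26
  obtain ⟨Mz, aC, δC, Bz, hM12z, haC, haC12, hδC, hB3z, hZfam⟩ := N06ZLettersLegAtPinsPUParJ.zletters_of_laws_J θ Mstar 𝔮 𝔮s parS Δ2 H12 f 𝔬12 hblkZ12 hCco12 hC1co12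
    ha12 hB12₀ hB12₃ hσ12 hδ30 hδ₃₀ BQp hBQp hqK BQ δQ hBQ hδQ hqsK hG0e he1 h26
  have hBz0 : 0 ≤ Bz := hB12₃.trans hB3z
  -- the master rates of the two leaves, scaled AFTER δC (`…N06ZLettersLegAtPinsPU.scaled_rates`: λ := min 1 (δC ∕ (ρ12 + 2σ12)); the leaf budgets are homogeneous or only easier)
  obtain ⟨ρs, σs, ρfs, ρ13s, hσs, hρs, hρfs, hρ13s, hρSs, hρδs, hρPs, hρ3s, hρC1, hρf1s, hρf2s, hρ13ρs, hρ13ρ3s, hσρ13s, hρHs⟩ :=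
    scaled_rates hσ12 hρ12 hρf12 hρ13 hρS12 hρδ12 hρP12 hδP₃ hρf1 hρf2 hρ13ρ hσρ13 hδC
  obtain ⟨ML12, c12, hrow12⟩ := rowSum261_geo9Y (d := θ.d₆) (ℓ := θ.ℓ₆) (hd := θ.hd') (hL := θ.hL') (b₀ := θ.b₀) (b₁ := θ.b₁) (Mstar := Mstar) σs hσs
  have hrow : ∀ x : MemberY θ.d₆ θ.ℓ₆ θ.hd' θ.hL' θ.b₀ θ.b₁ Mstar, ML12 ≤ (geo9Y x).M → RowSum (toB6 (geo9Y x) 1 (H12 x)) σs (max c12 0) := fun x hM y => (hrow12 x hM y).trans (le_max_left _ _)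
  -- thresholds of the two leaves: the displayed families at M12 ∕ a12 are read above Ms ≥ Mz ≥ M12 and below aC ≤ a12
  set Ms : ℝ := max Mz ML12 with hMsd
  have hMzs : Mz ≤ Ms := le_max_left _ _
  have hM12s : M12 ≤ Ms := hM12z.trans hMzs
  have hMLs : ML12 ≤ Ms := le_max_right _ _
  have hMs : 0 < Ms := lt_max_of_lt_left (hM12.trans_le hM12z)
  have hE : (fun x K => (𝔒 x).HasRWExp (kernelFamilyRY K)) = fun x => HasRWExpOfOps (𝔬12 x) := by funext x; rw [hpinE x]; rfl
  have hH : (fun x K => (𝔒 x).HasRWExpH (hKernelRY K)) = fun x => HasRWExpHOfOps (𝔬12 x) := by funext x; rw [hpinH x]; rfl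
  have hK' : (fun x K => (𝔒 x).PosDefK (kernelFamilyRY K)) = fun x => PosDefKOfOps (𝔬12 x) := by funext x; rw [hpinK x]; rfl
  have hη : ∀ x : MemberY θ.d₆ θ.ℓ₆ θ.hd' θ.hL' θ.b₀ θ.b₁ Mstar, 0 < (geo9Y x).eta := fun x => (distOK_geo9Y x).eta_pos
  have hL21 := lemma21AboveG_geo9Y (d := θ.d₆) (ℓ := θ.ℓ₆) (hd := θ.hd') (hL := θ.hL') (b₀ := θ.b₀) (b₁ := θ.b₁) (Mstar := Mstar) H12 hα12 (hα12'.trans_lt one_half_lt_one)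
  have hL21f : ∀ δ : ℝ, 0 < δ → ∃ ML' c' : ℝ, B9Thm312WholeLeft.Lemma21AboveG (fun j : J => geo9Y (f j)) (fun _ => (1 : ℝ)) (fun j => H12 (f j)) δ α12 ML' c' := by
    intro δ hδ; obtain ⟨ML', c', h⟩ := hL21 δ hδ; exact ⟨ML', c', fun j hM => h (f j) hM⟩
  -- the letters of H for ROW 20 at (Bz, min δ12₃ δC), packaged by the leg
  have hHZ := fun j (hM : Ms ≤ (geo9Y (f j)).M) (α₀ : ℝ) (hα : 0 < α₀) (ha : (geo9Y (f j)).M * α₀ ≤ aC) (U : (bg9YR (Matrix (Fin N) (Fin N) ℂ) (specialUnitaryUnits (Fin N)) R₁ R₂ (f j)).Cfg) (hU : (bg9YR (Matrix (Fin N) (Fin N) ℂ) (specialUnitaryUnits (Fin N)) R₁ R₂ (f j)).Reg335 c α₀ U) (hU' : (bg9YR (Matrix (Fin N) (Fin N) ℂ) (specialUnitaryUnits (Fin N)) R₁ R₂ (f j)).Reg336 c α₀ U) =>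
    (hZfam j (hMzs.trans hM) α₀ hα ha U hU hU').2.2.2.2.2.2
  have hEx := fun x K => congrFun (congrFun hE x) K
  have hHx := fun x K => congrFun (congrFun hH x) K
  have hK'x := fun x K => congrFun (congrFun hK' x) K
  beta_reduce at hEx hHx hK'x
  refine ⟨?_, ?_⟩
  · simp only [hEx, hHx, hK'x]
    simp only [e𝔒GD, e𝔒G1, e𝔒H, e𝔒H1]
    exact thm312Printed_completePairMBZSL_ratesC (fun j => 𝔬12 (f j)) (fun _ => 1) (fun j => H12 (f j)) (fun j => 𝔭A (f j)) (fun j => bHX12 (f j)) (fun j => (Dd (f j))) (fun j => (Dds (f j))) (fun j => kernelFamilyB (f j).toKIdx (bg9YR (Matrix (Fin N) (Fin N) ℂ) (specialUnitaryUnits (Fin N)) R₁ R₂ (f j)) (fun U => U) (𝔏 (f j)).GD (𝔏 (f j)).parB)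
      (fun j => kernelFamilyB (f j).toKIdx (bg9YR (Matrix (Fin N) (Fin N) ℂ) (specialUnitaryUnits (Fin N)) R₁ R₂ (f j)) (fun U => U) (𝔏 (f j)).G₁ (𝔏 (f j)).parB) (fun j => hKernelOfOp (f j).toKIdx (bg9YR (Matrix (Fin N) (Fin N) ℂ) (specialUnitaryUnits (Fin N)) R₁ R₂ (f j)) (fun U => U) (𝔏 (f j)).H (𝔏 (f j)).parB)
      (fun j => hKernelOfOp (f j).toKIdx (bg9YR (Matrix (Fin N) (Fin N) ℂ) (specialUnitaryUnits (Fin N)) R₁ R₂ (f j)) (fun U => U) (𝔏 (f j)).H₁ (𝔏 (f j)).parB) (fun j => evBK (f j).toKIdx) (fun j => evBK (f j).toKIdx) (fun j => RelB (f j).toKIdx) (2 * (θ.d₆ + 1))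
      (nbrCountY θ.d₆ θ.ℓ₆ θ.hd' θ.hL' θ.b₀ θ.b₁ 2) (fun j U => weightNorm (bXH (f j) U) (rwt (geo9Y (f j)) (-1)) (rwt_nonneg (fun y => (geo9Y_len_pos (f j) y).le) (-1))) (fun j => bXH (f j)) 2
      (Real.sqrt ((θ.d₆ + 1) * Fintype.card (TrIdx N))) ((θ.ℓ₆ + 1 : ℕ) : ℝ) θS θD12 θ2₁₂ r12 B12₀ B12₂ δ12₀ δK12 σs (max c12 0) ρs ρfs aC Ms ML12 Bz δ12₃ (min δ12₃ δC) α12 ((θ.ℓ₆ + 1 : ℕ) : ℝ) κS A₀S CR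
      δP δP AQ AD CR Bh12 Bi12 Bq12 θH12 AI Bi2₁₂ hθS hθD12 hθH12 hθ2₁₂ hr12 hB12₀ hB12₂ hBz0 hκS hA₀S hCR hAI hδP₀ hδP₃ hρHs hσs.le hρs hρPs hρδs hρPs (le_max_right _ _) haC hMs hα12' hα12.le
      hρfs hρf1s hρf2s hBh12 hBi12 hBi2₁₂ hBq12 (Real.sqrt_nonneg _) one_le_L_nat (fun j => hgeoOK (f j)) (fun j => modelSignsOn_geo9K (f j).toKIdx) (fun _ => hL1) (fun _ => le_rfl) one_le_L_nat (fun j => hη (f j)) (fun j => hrow (f j)) hL21f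
      (fun j => hnbr_two_of_le hM₀ (f j)) (fun j a a' h => len_le_of_dist_le_two_geo9Y (f j) a a' h) (fun j => hsat (f j)) (fun j => hmult (f j)) (fun j => hRdist (f j)) (fun j => hRlen (f j)) (fun j => hcoR12 (f j)) (fun j => hco1R12 (f j)) (fun j => hcoHR12 (f j)) (fun j => hcoG12 (f j))
      (fun j U => ⟨⟨(hDL (f j) U).1, (hDL (f j) U).2.1, (hDL (f j) U).2.2, (hDL3 (f j) U).1, (hDL3 (f j) U).2.1, (hDL3 (f j) U).2.2⟩, ⟨(h1L (f j) U).1, (h1L (f j) U).2.1, (h1L (f j) U).2.2, (h1L3 (f j) U).1, (h1L3 (f j) U).2.1, (h1L3 (f j) U).2.2⟩⟩)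
      (fun j U => ⟨(hH1N (f j) U).1, (hH1N (f j) U).2.1⟩) (fun j U => ⟨(hIF (f j) U).1, (hIF (f j) U).2.1⟩) (fun j => hHCN (f j)) (fun j hM α₀ hα ha => hsym12 (f j) (hM12s.trans hM) α₀ hα (ha.trans haC12)) (fun j hM α₀ hα ha => hmodel12 j (hM12s.trans hM) α₀ hα (ha.trans haC12)) (fun j hM α₀ hα ha => he1 (f j) (hM12s.trans hM) α₀ hα (ha.trans haC12))
      (fun j => weightNorm (BlockNorm.ofBlocks (toB6 (geo9Y (f j)) 1 (H12 (f j))) (𝔬12 (f j)).blkZ) (fun y => ((((θ.ℓ₆ + 1 : ℕ) : ℝ) ^ (θ.d₆ + 1)) ^ lvl (f j).hN (f j).D (f j).hk y)⁻¹) (fun y => (plateau_pos (f j).toKIdx y).le)) (fun _ => rfl) hHZ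
      (fun j hM α₀ hα ha U hU hU' => ⟨(hG0C (f j) (hM12s.trans hM) α₀ hα (ha.trans haC12) U hU hU').1, (hG0C (f j) (hM12s.trans hM) α₀ hα (ha.trans haC12) U hU hU').2.2⟩) (fun j hM α₀ hα ha => hStL j (hM12s.trans hM) α₀ hα (ha.trans haC12)) (fun j hM α₀ hα ha => hLHH (f j) (hM12s.trans hM) α₀ hα (ha.trans haC12)) (fun j => hdomX (f j)) (fun j hM α₀ hα ha => hst20 j (hM12s.trans hM) α₀ hα (ha.trans haC12)) (fun j hM α₀ hα ha => hst10 j (hM12s.trans hM) α₀ hα (ha.trans haC12))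
  · simp only [hEx, hK'x]
    simp only [e𝔒GG]
    exact thm313Printed_completePairMBCZcUSXCEL (fun j => 𝔬12 (f j)) (fun _ => 1) (fun j => H12 (f j)) (fun j => kernelFamilyB (f j).toKIdx (bg9YR (Matrix (Fin N) (Fin N) ℂ) (specialUnitaryUnits (Fin N)) R₁ R₂ (f j)) (fun U => U) (𝔏 (f j)).GG (𝔏 (f j)).parB) (fun j => bH13 (f j)) (fun j => 𝔭A (f j)) (fun j => bHX12 (f j)) (fun j => Gp (f j)) (fun j => bXH (f j)) (fun j => Dd (f j)) (fun j => Dds (f j)) (fun j => bHW13 (f j))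
      (fun j U => weightNorm (bXH (f j) U) (rwt (geo9Y (f j)) (-1)) (rwt_nonneg (fun y => (geo9Y_len_pos (f j) y).le) (-1))) (fun j => bXH (f j)) (fun j => evBK (f j).toKIdx) (fun j => evBK (f j).toKIdx) (fun j => RelB (f j).toKIdx)
      (2 * (θ.d₆ + 1)) (nbrCountY θ.d₆ θ.ℓ₆ θ.hd' θ.hL' θ.b₀ θ.b₁ 2) 2 (Real.sqrt ((θ.d₆ + 1) * Fintype.card (TrIdx N))) ((θ.ℓ₆ + 1 : ℕ) : ℝ) θS θD12 θ2₁₂ r12 B12₀ B12₂ B13₄ Bz δ12₀ δK12 δP σs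
      (max c12 0) ρs aC Ms ML12 Bz δ12₃ δC ρ13s α12 ((θ.ℓ₆ + 1 : ℕ) : ℝ) κ13 κS A₀S AW AQ AD AQ1 CR CR Bh12 Bi12 Bq12 BhD13 Bx13 Bd13 θH12 AI AV Br13 Bi2₁₂ Bd2₁₃ hθS hθD12 hθH12 hθ2₁₂ hκS
      hA₀S hAW hAQ hAD hAQ1 hCR hCR hAI hAV hr12 hB12₀ hB12₂ hBz0 hB13₄ hBr13 hσs.le hρ13s hρ13ρ3s hρ13ρs hσρ13s hρSs hρ3s hρC1
      hρδs hρPs (le_max_right _ _) haC hMs hα12.le hBi12 hBd13 hBi2₁₂ hBd2₁₃ hBh12 (fun β _ _ => hBq12 β) hBhD13 hBx13 (Real.sqrt_nonneg _) one_le_L_nat (fun j => hgeoOK (f j))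
      (fun j => modelSignsOn_geo9K (f j).toKIdx) (fun _ => hL1) (fun _ => le_rfl) (fun j => hη (f j)) (fun j => hκ13 (f j)) (fun j => hκW13 (f j)) (fun j => hκX (f j)) (fun j U => by simp only [weightNorm_κ]; exact (hκX (f j) U).trans hκ13S)
      (fun j U => (hκX (f j) U).trans hκ13S) (fun _ _ => rfl) (hADB12.trans hB3z) (fun j => hrow (f j)) hL21f (fun j => hnbr_two_of_le hM₀ (f j)) (fun j a a' h => len_le_of_dist_le_two_geo9Y (f j) a a' h) (fun j => hsat (f j)) (fun j => hmult (f j)) (fun j => hcoR13 (f j)) (fun j => hco1R13 (f j)) (fun j => hcoG13 (f j)) (fun j hM α₀ hα ha => hsym13 (f j) (hM12s.trans hM) α₀ hα (ha.trans haC12))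
      (fun j U => ⟨(hGL (f j) U).1, (hGL (f j) U).2.1, (hGL (f j) U).2.2, (hGL3 (f j) U).1, (hGL3 (f j) U).2.1, (hGL3 (f j) U).2.2⟩) (fun j U => (hH1N (f j) U).2.2) (fun j U => (hIF (f j) U).2.2) (fun j => hRdist (f j)) (fun j hM α₀ hα ha => hmodel12 j (hM12s.trans hM) α₀ hα (ha.trans haC12)) (fun j hM α₀ hα ha => he1 (f j) (hM12s.trans hM) α₀ hα (ha.trans haC12)) (fun (j : J) (y : (geo9Y (f j)).Site) => ((((θ.ℓ₆ + 1 : ℕ) : ℝ) ^ (θ.d₆ + 1)) ^ lvl (f j).hN (f j).D (f j).hk y)⁻¹) (fun j y => plateau_pos (f j).toKIdx y)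
      (fun j hM α₀ hα ha U hU hU' =>
        have ks := fun (a b : (geo9Y (f j)).Site) => kernel_mono (hgeoOK (f j)) hB12₃ hB3z (le_refl δ12₃) a b
        have hz := hZfam j (hMzs.trans hM) α₀ hα ha U hU hU'
        ⟨(hZ2 (f j) (hM12s.trans hM) α₀ hα (ha.trans haC12) U hU hU').1.mono ks, hz.2.1, (hZ2 (f j) (hM12s.trans hM) α₀ hα (ha.trans haC12) U hU hU').2.mono ks, (hrgd2_13 j (hM12s.trans hM) α₀ hα (ha.trans haC12) U hU hU').mono ks,
          hz.2.2.2.2.1, hz.2.2.2.2.2.1, hz.1 2 le_rfl, hz.1 1 (by norm_num)⟩)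
      (fun j hM α₀ hα ha U hU hU' => (hwGp13 j (hM12s.trans hM) α₀ hα (ha.trans haC12) U hU hU').mono fun a b => kernel_mono (hgeoOK (f j)) hB12₃ hB3z (le_refl δ12₃) a b) (fun j hM α₀ hα ha => h152 j (hM12s.trans hM) α₀ hα (ha.trans haC12))
      (fun j hM α₀ hα ha U hU hU' =>
        have ks := fun (a b : (geo9Y (f j)).Site) => kernel_mono (hgeoOK (f j)) hB12₃ hB3z (le_refl δ12₃) a b
        ⟨⟨(hZfam j (hMzs.trans hM) α₀ hα ha U hU hU').2.2.1, (hrgdH13 j (hM12s.trans hM) α₀ hα (ha.trans haC12) U hU hU').mono ks, (hdgDH13 (f j) (hM12s.trans hM) α₀ hα (ha.trans haC12) U hU hU').mono ks⟩,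
        letters313DMZ_mono (hgeoOK (f j)) hB12₃ hB3z (fun β _ _ => hBq12 β) (fun β _ _ => le_refl (Bq12 β)) le_rfl (hlettersDM13 (f j) (hM12s.trans hM) α₀ hα (ha.trans haC12) U hU hU')⟩)
      (fun j hM α₀ hα ha U hU hU' => ⟨(hG0C (f j) (hM12s.trans hM) α₀ hα (ha.trans haC12) U hU hU').1, (hG0C (f j) (hM12s.trans hM) α₀ hα (ha.trans haC12) U hU hU').2.1⟩) (fun j hM α₀ hα ha => hLHH (f j) (hM12s.trans hM) α₀ hα (ha.trans haC12)) (fun j hM α₀ hα ha => hLH3 j (hM12s.trans hM) α₀ hα (ha.trans haC12))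
      (fun j hM α₀ hα ha U hU hU' => (hG0C (f j) (hM12s.trans hM) α₀ hα (ha.trans haC12) U hU hU').2.2) (fun j hM α₀ hα ha => hStL j (hM12s.trans hM) α₀ hα (ha.trans haC12)) (fun (j : J) (y : (geo9Y (f j)).Site) => Real.sqrt ((((θ.ℓ₆ + 1 : ℕ) : ℝ) ^ (θ.d₆ + 1)) ^ lvl (f j).hN (f j).D (f j).hk y)⁻¹) (fun j y => Real.sqrt_pos.2 (plateau_pos (f j).toKIdx y)) (fun j hM α₀ hα ha => hLL2 j (hM12s.trans hM) α₀ hα (ha.trans haC12))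
      (fun j hM α₀ hα ha U hU hU' => c1_l2_of_c1_2 (R₀ := (1 : ℝ)) (H₀ := H12 (f j)) (hgeoOK (f j)) hBz0 (fun y => plateau_pos (f j).toKIdx y) (hZfam j (hMzs.trans hM) α₀ hα ha U hU hU').2.2.2.2.1 (hC1T (f j) (hM12s.trans hM) α₀ hα (ha.trans haC12) U hU hU')) (fun j hM α₀ hα ha => hrgdd13 j (hM12s.trans hM) α₀ hα (ha.trans haC12)) (fun j hM α₀ hα ha => hdgDvd13 (f j) (hM12s.trans hM) α₀ hα (ha.trans haC12)) (fun j hM α₀ hα ha => hpdgDvd13 (f j) (hM12s.trans hM) α₀ hα (ha.trans haC12)) (fun j => hdomX (f j)) (fun j => hdomW (f j)) (fun j hM α₀ hα ha => hst21 j (hM12s.trans hM) α₀ hα (ha.trans haC12)) (fun j hM α₀ hα ha => hst11 j (hM12s.trans hM) α₀ hα (ha.trans haC12))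

end Pointed

end Summit.QuantumFields.YangMills.BalabanUVNodes.N06Thm312313AtPinsStateSUCLEParGJB

end
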